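import Literature.MathematicalPhysics.QuantumFieldTheory.Balaban1983to89.B9Thm314QGGQInvFlatTransfer
import Literature.MathematicalPhysics.QuantumFieldTheory.Balaban1983to89.B9Thm314GpFlatL2
import Literature.MathematicalPhysics.QuantumFieldTheory.Balaban1983to89.B6Ineq288MultiLevelTorus

/-!
# `Balaban1983to89.B9Thm314PFlatTransfer` — [B9] THEOREM 3.14 (pp. 426–427, (3.154)) AT `U = 1` FOR PRINT'S
`P = I − R = G′Q′*(Q′G′²Q′*)⁻¹Q′G′` ((3.25) p. 394, characteristic inequality (3.49) p. 399 = [4] (2.17)/(2.88)) ON THE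
GENUINE `k`-LEVEL TORUS, FILE 1 OF 2: the transfer-telescoping identity between the two block lattices and the estimates
of its three terms (no existing module is touched; no `def`; no fact is minted)

FRAMING (verbatim cell line):
statement-level skeleton of published theorems with citation tags; proofs where landed; nothing here is a claim about the Yang–Mills mass gap

Sources under audit (cell pub-balaban / lit-balaban): T. Bałaban, *Propagators for lattice gauge theories in a
background field*, Commun. Math. Phys. **99** (1985) 389–434 [`Balaban1985BackgroundPropagators`, "B9"], pp. 426–427
[PDF 38–39] (Theorem 3.14, (3.154)), p. 399 [PDF 11] ((3.49)), p. 394 [PDF 6] ((3.25)), p. 398 [PDF 10] (the scale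
remark) — held text `paper:balaban1985-cmp99-background-propagators` p0038/p0039/p0011/p0010 read this generation;
T. Bałaban, *Propagators and renormalization transformations for lattice gauge theories. II*, Commun. Math. Phys. **96**
(1984) 223–250 [`Balaban1984PropagatorsII`, "[4]"], (2.17) p. 225, Prop. 2.3 (2.87)–(2.88) p. 238, (2.60)–(2.61)
p. 234, (2.69) p. 235.  Unit `lit-balaban-p21` (Phase-2 proof seat p21 gen 19, HOME `run/shared/lean/pub/lit-balaban/`,
free-target protocol G.5-34(d); B9 fold owner r06, B6 fold owner r03, referee ref-4).

## WHAT IS PRINTED (quotations AS PRINTED)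

B9 p. 426 (scan p038): «Let us take localizations determined by points y, y′ ∈ Ω^{(k)} (i.e. these are cubes Δ̃(y),
Δ̃(y′) in the case of operators G′, G, G₁, 𝔊, the cube Δ̃(y) and the point y′ in the case of H, H₁, and the points y, y′
in the case of (Q′G′²Q′*)⁻¹, (QGQ*)⁻¹, etc.). We have **Theorem 3.14.** If we take a pair of operators constructed for
the two sequences {Ω_j}, {Ω′_j}, then their difference satisfies all the inequalities characteristic for operators of the
considered type, with the additional factor exp(−δ₀d(y, y′, Ω)), d(y, y′, Ω) = inf_{y₁∈Ωᶜ∩T^{(k)}} (|y − y₁| + |y₁ − y′|)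
(3.154) on the right-hand sides.»  B9 p. 399 (scan p011, L4–9): «These theorems imply all the properties of the operator
R, or DRD*, we will need in the future. For the operator P = I − R we obtain, using again Lemma 2.1,
[|P(x,x′)|, |(DP)_μ(x,x′)|, |(PD*)_ν(x,x′)|, |(DPD*)_{μν}(x,x′)|] ≦ O(1)[1, (L^jη)⁻¹, (L^{j′}η)⁻¹, (L^jη)⁻¹(L^{j′}η)⁻¹]
(L^{j′}η)^{−d}e^{−δ₀d(y,y′)} for x ∈ Δ(y), y ∈ Λ_j, x′ ∈ Δ(y′), y′ ∈ Λ_{j′}. (3.49)»; p. 394: «Rf = (I − G′Q′*(Q′G′²Q′*)⁻¹Q′G′)f,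
where G′ = G′(U) = (Δ′_a)⁻¹» (3.25); p. 398 L20–24: «Next, the choice of powers L^jη is conventional also. Using Lemma 2.1
in [4] we may replace the factor (L^jη)^α by (L^jη)^β(L^{j′}η)^γ with β + γ = α, j, j′ are indices of localizations».
p. 427: «We take random walk expansions for both operators, and in the difference all terms for walks with localizations
contained in Ω are cancelled. Remaining terms correspond to walks … for which at least one localization X_i intersects
Ωᶜ.»

## WHAT THIS FILE CERTIFIES (kernel-checked; lattice units `η = 1`; setting of `B9Thm314GpFlatTorusGeometry`: two
families `D, D′ : TDomains` on ONE torus `T_η`, `Ω = Ω_k ∩ Ω′_k`, `d(y,y′,Ω) = dOmega`)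

The word of (3.25) at `U = 1` is read, as in r05's `B9Ineq349MultiLevelTorus.pProjMLT`, as
`w[D](x, x′) = (T·Q′*·(Q′G′²Q′*)⁻¹[D]·Q′·S(x′, ·))(x)` with a left letter `T` (`G′[D]` or `∂_μG′[D]`), a right letter `S`
(`G′[D]` or `∂_νG′[D]`, through `G′` symmetric), `Q′ = QB`, `Q′* = QsB`, `(Q′G′²Q′*)⁻¹[D] = GinvT D a`
(`B6Prop23MultiLevelTorus`, (2.69)-kernel `CinvT D a`).
* §1 `transfer_pow`/`transfer_W`/`transfer_inv` — the (2.60) weight transfer at an arbitrary power `q` (`(L^k)^q/(L^j)^q·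
  e^{−σd_T} ≤ L^q` once `L^q ≤ e^{σ(R·L·M_h − 1)}`, `levelGap_le_distT`), in particular for the (2.69) volumes `W = (L^j)^{d+1}`;
  `pow_le_exp_of_threshold` (the «R sufficiently large» arithmetic); the (2.61) sums `sum_exp_le(')`.
* §2 `word_eq_sum` — `w[D](x,x′) = Σ_{u,v∈𝔅[D]} (Tλ_u)(x)·C(u,v)·(Sλ_v)(x′)` (`λ_u = 1_{B(u)}` = `B6Ineq288MultiLevelTorus.lam`);
  `sum_cc_transfer` (re-indexing over the COMMON TOP blocks = top level in both families); **`telescope`** /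
  **`word_sub_word`** — THE TRANSFER-TELESCOPING IDENTITY `w[D] − w[D′] = T_A + T_B + T_C`,
  `T_A = Σ_u (E − τ*E′)(u)(CF)(u)`, `T_B = Σ_{u′,v} E′(u′)(τC − C′τ)(u′,v)F(v)`, `T_C = Σ_{u′} (E′C′)(u′)(τF − F′)(u′)` (`τ` the
  identification of the common top blocks, written inline; on a common block `λ_u = λ′_u`, `lam_common`) — print's walk
  cancellation in resolvent form (pure linearity).
* §3 the estimates, all at one input rate `δ` with the (2.60)-thresholds at powers `2` and `d + 1` explicit:
  `inner_h_le` (`|(CF)(u)|`), **`termA_le`**, **`termB_le`** (the four cases: both common top ⇒ file `B9Thm314QGGQInvFlat…`'s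
  difference of the (2.69)-kernels; exactly one ⇒ the other block meets `Ωᶜ` (`exists_OmegaC_of_not_common`), §1 transfers,
  the witness inequality `dOmega_le_of_witness'`; neither ⇒ `0`), `inner_g_le` (`|(E′C′)(u′)|`), **`termC_le`** — each bounded by
  `K·L^{n_Lk}L^{n_Rk}L^{−4k}W(y′)⁻¹·e^{−¼δd(y,y′,Ω)}` times (2.61)-summable weights, `K` explicit in the input constants.
  File 2 (`B9Thm314PFlatMultiLevelTorus`) sums, adds the trivial bound and discharges every hypothesis from the torus
  lineage (gen-18 `thm314_Gp_sup_flat_multiLevelTorus`, `thm314_QGGQinv_flat_multiLevelTorus`, `prop22_entries1236_multiLevelTorus`,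
  `prop23_multiLevelTorus`, r05's `ineq349_multiLevelTorus_P23`).

## HONEST SCOPE

* `U = 1` only, torus lineage of this seat (`Ω₁ = T_η`, levels `1 … k`, lattice units, spatial dimension `d + 1`); the word
  is print's `P` of (3.25) and its one-sided/two-sided derivatives in r05's typing; the legs, middles and thresholds of §3
  are HYPOTHESES here (point-mass/(2.69) shapes), discharged in file 2; ONLY common top blocks `y ∋ x`, `y′ ∋ x′`.
* ROUTE (declared; `U = 1` admits it): transfer telescoping through the common top blocks in place of print's walk-expansion
  cancellation; the (2.60) transfers pay the scale/volume mismatches of the surviving terms (p. 398 remark), §1 of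
  `B9Thm314QGGQInvFlatTransfer` gives the (3.154) factor from one localisation in `Ωᶜ`.
* Nothing is inferred from the manuscript: every step is kernel-checked; the quoted sentences locate the statements.
-/

namespace Literature.MathematicalPhysics.QuantumFieldTheory.Balaban1983to89.B9Thm314PFlatTransfer

open Finset Matrix
open Literature.MathematicalPhysics.QuantumFieldTheory.Balaban1983to89.B4Reflection242 (boxDom blk)
open Literature.MathematicalPhysics.QuantumFieldTheory.Balaban1983to89.B6MultiLevelBoxOperator
open Literature.MathematicalPhysics.QuantumFieldTheory.Balaban1983to89.B6MultiLevelTorusOperator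
open Literature.MathematicalPhysics.QuantumFieldTheory.Balaban1983to89.B6Geom246MultiLevelBox
open Literature.MathematicalPhysics.QuantumFieldTheory.Balaban1983to89.B6Geom246MultiLevelTorus
open Literature.MathematicalPhysics.QuantumFieldTheory.Balaban1983to89.B8Ineq192MultiLevelTorus (geomTB geomTB_dist
  geomTB_L geomTB_RM geomTB_RM_nonneg levelSepTB lenT_eq symmT symmTB XkT W_eq_lenT_pow lenT_pos)
open Literature.MathematicalPhysics.QuantumFieldTheory.Balaban1983to89.B6Lemma21Repaired (Ineq261With)
open Literature.MathematicalPhysics.QuantumFieldTheory.Balaban1983to89.B6RandomWalk (HasMajorant BlockSupp)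
open Literature.MathematicalPhysics.QuantumFieldTheory.Balaban1983to89.B9Thm314GpFlatTorusGeometry
open Literature.MathematicalPhysics.QuantumFieldTheory.Balaban1983to89.B9Thm314GpFlatResolvent (blkOf_eq_iff_blkOf_eq)
open Literature.MathematicalPhysics.QuantumFieldTheory.Balaban1983to89.B9Thm314GpFlatL2 (dOmega_comm)
open Literature.MathematicalPhysics.QuantumFieldTheory.Balaban1983to89.B9Thm314QGGQInvFlatTransfer
open Literature.MathematicalPhysics.QuantumFieldTheory.Balaban1983to89.B6Ineq268MultiLevelBox (W W_pos W_eq QB QsB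
  QsB_apply QB_apply)
open Literature.MathematicalPhysics.QuantumFieldTheory.Balaban1983to89.B6Prop23MultiLevelTorus (GinvT CinvT mat_GinvT_div)
open Literature.MathematicalPhysics.QuantumFieldTheory.Balaban1983to89.B6Prop23Chain (mat mat_kerOp apply_eq_sum_mat)
open Literature.MathematicalPhysics.QuantumFieldTheory.Balaban1983to89.B6Expansion282 (kerOp)
open Literature.MathematicalPhysics.QuantumFieldTheory.Balaban1983to89.B6Ineq288MultiLevelTorus (lam)

noncomputable section

variable {d : ℕ}

/-! ## §1 The (2.60) weight transfers at an arbitrary power and the (2.61) sums -/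

section Transfer

variable {ℓ Mh k R : ℕ} {P : Fin (d + 1) → ℕ}

/-- the threshold arithmetic: `L^q ≤ e^{σN}` once `N ≥ qL/σ` (`log L ≤ L`). [cite: Balaban1984PropagatorsII, (2.59)–(2.60) p.234, bookkeeping] -/
theorem pow_le_exp_of_threshold {Lr σ N : ℝ} (hL : 1 ≤ Lr) (hσ : 0 < σ) (q : ℕ) (hN : q * Lr / σ ≤ N) :
    Lr ^ q ≤ Real.exp (σ * N) := by
  have hL0 : 0 < Lr := lt_of_lt_of_le one_pos hL
  have hlog : Real.log Lr ≤ Lr := (Real.log_le_sub_one_of_pos hL0).trans (by linarith)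
  have hlog0 : 0 ≤ Real.log Lr := Real.log_nonneg hL
  have h1 : (q : ℝ) * Lr ≤ σ * N := by
    rw [div_le_iff₀ hσ] at hN; linarith
  have hq0 : (0 : ℝ) ≤ q := Nat.cast_nonneg q
  calc Lr ^ q = Real.exp (Real.log Lr * q) := by
        rw [← Real.rpow_natCast, Real.rpow_def_of_pos hL0]
    _ ≤ Real.exp (σ * N) := Real.exp_le_exp.2 (by nlinarith [mul_le_mul_of_nonneg_left hlog hq0])

/-- **THE (2.60) WEIGHT TRANSFER AT POWER `q`**: for a top block `t` and any block `s` of one family,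
`(L^k)^q·((L^{j(s)})^q)⁻¹·e^{−σd(t,s)} ≤ L^q` once `L^q ≤ e^{σ(R·L·M_h − 1)}` (each crossing of an intermediate scale layer
costs `R·L·M_h − 1` in `d_T`, `levelGap_le_distT`; one layer is free).  B9 p. 398: «the choice of powers L^jη is conventional
also. Using Lemma 2.1 in [4] we may replace the factor (L^jη)^α by (L^jη)^β(L^{j′}η)^γ with β + γ = α».
[cite: Balaban1985BackgroundPropagators, p.398; Balaban1984PropagatorsII, (2.60) p.234, p.235] -/
theorem transfer_pow (D₀ : TDomains d ℓ Mh k P R) (hMh : 1 ≤ Mh) (hP : ∀ μ, 1 ≤ P μ)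
    (hRM : 1 ≤ R * ((ℓ + 1) * Mh)) {σ : ℝ} (hσ : 0 ≤ σ) (q : ℕ)
    (hthr : ((ℓ : ℝ) + 1) ^ q ≤ Real.exp (σ * ((R : ℝ) * (((ℓ : ℝ) + 1) * Mh) - 1)))
    (s t : ↥(bset D₀.toDomains)) (ht : t.1.1 = k) :
    (((ℓ : ℝ) + 1) ^ k) ^ q * ((((ℓ : ℝ) + 1) ^ s.1.1) ^ q)⁻¹ * Real.exp (-(σ * (geomT D₀).dist t s))
      ≤ ((ℓ : ℝ) + 1) ^ q := by
  have hL1 : (1 : ℝ) ≤ (ℓ : ℝ) + 1 := by linarith [(Nat.cast_nonneg ℓ : (0 : ℝ) ≤ ℓ)]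
  have hL0 : (0 : ℝ) < (ℓ : ℝ) + 1 := by positivity
  have hjk : s.1.1 ≤ k := (scale_bounds D₀.toDomains s).2
  have hd0 : 0 ≤ (geomT D₀).dist t s := (triangle_refl_nonneg_T D₀ hMh hP).2.2 t s
  have hgap := B6Prop23MultiLevelTorus.levelGap_le_distT D₀ hMh hP hRM t s
  have hlg : B6Ineq281MultiLevelBox.lgap D₀.toDomains t s = k - s.1.1 := by
    unfold B6Ineq281MultiLevelBox.lgap; rw [ht]; omega
  rcases Nat.eq_or_lt_of_le hjk with hj | hj
  · rw [hj, mul_inv_cancel₀ (by positivity), one_mul]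
    calc Real.exp (-(σ * (geomT D₀).dist t s)) ≤ 1 := Real.exp_le_one_iff.2 (by nlinarith)
      _ ≤ ((ℓ : ℝ) + 1) ^ q := one_le_pow₀ hL1
  · obtain ⟨m, hm⟩ : ∃ m, k = s.1.1 + (m + 1) := ⟨k - s.1.1 - 1, by omega⟩
    have hRM0 : 0 ≤ (R : ℝ) * (((ℓ : ℝ) + 1) * Mh) - 1 := by
      have : (1 : ℝ) ≤ (R : ℝ) * (((ℓ : ℝ) + 1) * Mh) := by exact_mod_cast hRM
      linarith
    have hcast : ((B6Ineq281MultiLevelBox.lgap D₀.toDomains t s - 1 : ℕ) : ℝ) = m := by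
      rw [hlg, show k - s.1.1 - 1 = m by omega]
    have hd : ((R : ℝ) * (((ℓ : ℝ) + 1) * Mh) - 1) * m ≤ (geomT D₀).dist t s := by rw [hcast] at hgap; exact hgap
    have hexp : Real.exp (-(σ * (geomT D₀).dist t s)) ≤ (((((ℓ : ℝ) + 1) ^ q) ^ m))⁻¹ := by
      have h1 : Real.exp (-(σ * (geomT D₀).dist t s))
          ≤ Real.exp (-(σ * (((R : ℝ) * (((ℓ : ℝ) + 1) * Mh) - 1) * m))) :=
        Real.exp_le_exp.2 (by nlinarith [mul_le_mul_of_nonneg_left hd hσ])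
      have h2 : (((ℓ : ℝ) + 1) ^ q) ^ m ≤ Real.exp (σ * (((R : ℝ) * (((ℓ : ℝ) + 1) * Mh) - 1) * m)) := by
        calc (((ℓ : ℝ) + 1) ^ q) ^ m ≤ (Real.exp (σ * ((R : ℝ) * (((ℓ : ℝ) + 1) * Mh) - 1))) ^ m :=
              pow_le_pow_left₀ (by positivity) hthr m
          _ = Real.exp (σ * (((R : ℝ) * (((ℓ : ℝ) + 1) * Mh) - 1) * m)) := by
              rw [← Real.exp_nat_mul]; ring_nf
      calc Real.exp (-(σ * (geomT D₀).dist t s))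
          ≤ Real.exp (-(σ * (((R : ℝ) * (((ℓ : ℝ) + 1) * Mh) - 1) * m))) := h1
        _ = (Real.exp (σ * (((R : ℝ) * (((ℓ : ℝ) + 1) * Mh) - 1) * m)))⁻¹ := by rw [Real.exp_neg]
        _ ≤ ((((ℓ : ℝ) + 1) ^ q) ^ m)⁻¹ := inv_anti₀ (by positivity) h2
    have hk : ((ℓ : ℝ) + 1) ^ k = ((ℓ : ℝ) + 1) ^ s.1.1 * ((((ℓ : ℝ) + 1) ^ m) * ((ℓ : ℝ) + 1)) := by
      rw [← pow_succ, ← pow_add, ← hm]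
    have hratio : (((ℓ : ℝ) + 1) ^ k) ^ q * ((((ℓ : ℝ) + 1) ^ s.1.1) ^ q)⁻¹
        = (((ℓ : ℝ) + 1) ^ q) ^ m * ((ℓ : ℝ) + 1) ^ q := by
      have hne : (((ℓ : ℝ) + 1) ^ s.1.1) ^ q ≠ 0 := by positivity
      calc (((ℓ : ℝ) + 1) ^ k) ^ q * ((((ℓ : ℝ) + 1) ^ s.1.1) ^ q)⁻¹
          = (((ℓ : ℝ) + 1) ^ s.1.1) ^ q * (((((ℓ : ℝ) + 1) ^ m) ^ q * ((ℓ : ℝ) + 1) ^ q))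
              * ((((ℓ : ℝ) + 1) ^ s.1.1) ^ q)⁻¹ := by rw [hk, mul_pow, mul_pow]
        _ = (((ℓ : ℝ) + 1) ^ m) ^ q * ((ℓ : ℝ) + 1) ^ q := by
            rw [mul_comm, ← mul_assoc, inv_mul_cancel₀ hne, one_mul]
        _ = (((ℓ : ℝ) + 1) ^ q) ^ m * ((ℓ : ℝ) + 1) ^ q := by rw [← pow_mul, ← pow_mul, mul_comm m q]
    have hqm : 0 < (((ℓ : ℝ) + 1) ^ q) ^ m := by positivity
    calc (((ℓ : ℝ) + 1) ^ k) ^ q * ((((ℓ : ℝ) + 1) ^ s.1.1) ^ q)⁻¹ * Real.exp (-(σ * (geomT D₀).dist t s))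
        = (((ℓ : ℝ) + 1) ^ q) ^ m * ((ℓ : ℝ) + 1) ^ q * Real.exp (-(σ * (geomT D₀).dist t s)) := by rw [hratio]
      _ ≤ (((ℓ : ℝ) + 1) ^ q) ^ m * ((ℓ : ℝ) + 1) ^ q * ((((ℓ : ℝ) + 1) ^ q) ^ m)⁻¹ :=
          mul_le_mul_of_nonneg_left hexp (by positivity)
      _ = ((ℓ : ℝ) + 1) ^ q := by field_simp

/-- **THE (2.69)-VOLUME TRANSFER**: `W(s)⁻¹·e^{−σd(t,s)} ≤ L^{d+1}·W(t)⁻¹` for a top block `t` (`W = (L^j)^{d+1}`, power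
`d + 1` of `transfer_pow`) — how the factor `(L^{j′}η)^{−d}` of (3.49)/(2.88) rides from an intermediate block to the
localisation block. [cite: Balaban1985BackgroundPropagators, (3.49) p.399, p.398; Balaban1984PropagatorsII, (2.69) p.235, (2.88) p.238] -/
theorem transfer_W (D₀ : TDomains d ℓ Mh k P R) (hMh : 1 ≤ Mh) (hP : ∀ μ, 1 ≤ P μ)
    (hRM : 1 ≤ R * ((ℓ + 1) * Mh)) {σ : ℝ} (hσ : 0 ≤ σ)
    (hthr : ((ℓ : ℝ) + 1) ^ (d + 1) ≤ Real.exp (σ * ((R : ℝ) * (((ℓ : ℝ) + 1) * Mh) - 1)))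
    (s t : ↥(bset D₀.toDomains)) (ht : t.1.1 = k) :
    (W D₀.toDomains s)⁻¹ * Real.exp (-(σ * (geomT D₀).dist t s))
      ≤ ((ℓ : ℝ) + 1) ^ (d + 1) * (W D₀.toDomains t)⁻¹ := by
  have h := transfer_pow D₀ hMh hP hRM hσ (d + 1) hthr s t ht
  rw [W_eq, W_eq, ht]
  have hWt : (0 : ℝ) < (((ℓ : ℝ) + 1) ^ k) ^ (d + 1) := by positivity
  calc ((((ℓ : ℝ) + 1) ^ s.1.1) ^ (d + 1))⁻¹ * Real.exp (-(σ * (geomT D₀).dist t s))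
      = ((((ℓ : ℝ) + 1) ^ k) ^ (d + 1))⁻¹ * ((((ℓ : ℝ) + 1) ^ k) ^ (d + 1)
          * ((((ℓ : ℝ) + 1) ^ s.1.1) ^ (d + 1))⁻¹ * Real.exp (-(σ * (geomT D₀).dist t s))) := by
        field_simp
    _ ≤ ((((ℓ : ℝ) + 1) ^ k) ^ (d + 1))⁻¹ * ((ℓ : ℝ) + 1) ^ (d + 1) := mul_le_mul_of_nonneg_left h (by positivity)
    _ = ((ℓ : ℝ) + 1) ^ (d + 1) * ((((ℓ : ℝ) + 1) ^ k) ^ (d + 1))⁻¹ := mul_comm _ _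

/-- the same transfer in pure powers: `((L^{j(s)})^q)⁻¹·e^{−σd(t,s)} ≤ L^q·((L^k)^q)⁻¹` for a top block `t`.
[cite: Balaban1985BackgroundPropagators, p.398; Balaban1984PropagatorsII, (2.60) p.234] -/
theorem transfer_inv (D₀ : TDomains d ℓ Mh k P R) (hMh : 1 ≤ Mh) (hP : ∀ μ, 1 ≤ P μ)
    (hRM : 1 ≤ R * ((ℓ + 1) * Mh)) {σ : ℝ} (hσ : 0 ≤ σ) (q : ℕ)
    (hthr : ((ℓ : ℝ) + 1) ^ q ≤ Real.exp (σ * ((R : ℝ) * (((ℓ : ℝ) + 1) * Mh) - 1)))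
    (s t : ↥(bset D₀.toDomains)) (ht : t.1.1 = k) :
    ((((ℓ : ℝ) + 1) ^ s.1.1) ^ q)⁻¹ * Real.exp (-(σ * (geomT D₀).dist t s))
      ≤ ((ℓ : ℝ) + 1) ^ q * ((((ℓ : ℝ) + 1) ^ k) ^ q)⁻¹ := by
  have h := transfer_pow D₀ hMh hP hRM hσ q hthr s t ht
  have hWt : (0 : ℝ) < (((ℓ : ℝ) + 1) ^ k) ^ q := by positivity
  calc ((((ℓ : ℝ) + 1) ^ s.1.1) ^ q)⁻¹ * Real.exp (-(σ * (geomT D₀).dist t s))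
      = ((((ℓ : ℝ) + 1) ^ k) ^ q)⁻¹ * ((((ℓ : ℝ) + 1) ^ k) ^ q
          * ((((ℓ : ℝ) + 1) ^ s.1.1) ^ q)⁻¹ * Real.exp (-(σ * (geomT D₀).dist t s))) := by
        field_simp
    _ ≤ ((((ℓ : ℝ) + 1) ^ k) ^ q)⁻¹ * ((ℓ : ℝ) + 1) ^ q := mul_le_mul_of_nonneg_left h (by positivity)
    _ = ((ℓ : ℝ) + 1) ^ q * ((((ℓ : ℝ) + 1) ^ k) ^ q)⁻¹ := mul_comm _ _

/-- the (2.61) sum at `¼δ` around a block, `Σ_s e^{−¼δd(t,s)} ≤ c`. [cite: Balaban1984PropagatorsII, Lemma 2.1 (2.61) p.234] -/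
theorem sum_exp_le (D₀ : TDomains d ℓ Mh k P R) {c δ : ℝ} (h261 : Ineq261With c (geomT D₀) δ (1 / 4))
    (t : ↥(bset D₀.toDomains)) :
    ∑ s : ↥(bset D₀.toDomains), Real.exp (-(δ / 4 * (geomT D₀).dist t s)) ≤ c := by
  have h := h261 t
  calc ∑ s : ↥(bset D₀.toDomains), Real.exp (-(δ / 4 * (geomT D₀).dist t s))
      = ∑ s : ↥(bset D₀.toDomains), Real.exp (-(1 / 4 * δ * (geomT D₀).dist t s)) :=
        Finset.sum_congr rfl fun s _ => by congr 1; ring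
    _ ≤ c := h

/-- … and with the arguments of `d` exchanged (`d_T` is symmetric). [cite: Balaban1984PropagatorsII, Lemma 2.1 (2.61) p.234, (2.46) p.231] -/
theorem sum_exp_le' (D₀ : TDomains d ℓ Mh k P R) {c δ : ℝ} (h261 : Ineq261With c (geomT D₀) δ (1 / 4))
    (t : ↥(bset D₀.toDomains)) :
    ∑ s : ↥(bset D₀.toDomains), Real.exp (-(δ / 4 * (geomT D₀).dist s t)) ≤ c := by
  calc ∑ s : ↥(bset D₀.toDomains), Real.exp (-(δ / 4 * (geomT D₀).dist s t))
      = ∑ s : ↥(bset D₀.toDomains), Real.exp (-(δ / 4 * (geomT D₀).dist t s)) :=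
        Finset.sum_congr rfl fun s _ => by rw [symmT D₀ s t]
    _ ≤ c := sum_exp_le D₀ h261 t

/-- the (2.61)-constant is non-negative. [cite: Balaban1984PropagatorsII, Lemma 2.1 (2.61) p.234, bookkeeping] -/
theorem c261_nonneg (D₀ : TDomains d ℓ Mh k P R) {c δ : ℝ} (h261 : Ineq261With c (geomT D₀) δ (1 / 4))
    (t : ↥(bset D₀.toDomains)) : 0 ≤ c :=
  le_trans (Finset.sum_nonneg fun _ _ => (Real.exp_pos _).le) (h261 t)

end Transfer

/-! ## §2 The word `T·Q′*·(Q′G′²Q′*)⁻¹·Q′·S` in block sums, the identification of the common top blocks, and the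
transfer-telescoping identity -/

section Expansion

variable {ℓ Mh k R : ℕ} {P : Fin (d + 1) → ℕ}

/-- `λ_u = 1_{B(u)}`, unfolded. [cite: Balaban1984PropagatorsII, (2.51) p.232, dictionary] -/
theorem lam_apply (D₀ : TDomains d ℓ Mh k P R) (u : ↥(bset D₀.toDomains)) (z : ↥(boxDom (N0 ℓ Mh k P))) :
    lam D₀ u z = if blkOf D₀.toDomains z = u then 1 else 0 := rfl

/-- `λ_u` is a test function of the block `u` with `|λ_u| ≤ 1` («supp λ ⊂ B(y′)»). [cite: Balaban1984PropagatorsII, (2.51) p.232] -/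
theorem blockSupp_lam (D₀ : TDomains d ℓ Mh k P R) (u : ↥(bset D₀.toDomains)) :
    BlockSupp (g := geomT D₀) (blkOf D₀.toDomains) (lam D₀ u) u 1 :=
  ⟨zero_le_one, fun z hz => by simp [lam_apply, hz], fun z hz => by simp only [lam_apply]; exact if_neg hz⟩

/-- on a COMMON block the test functions of the two families coincide. [cite: Balaban1984PropagatorsII, (2.45) p.231, dictionary] -/
theorem lam_common (D D' : TDomains d ℓ Mh k P R) {p : ℕ × (Fin (d + 1) → ℤ)} (hp : p ∈ bset D.toDomains)
    (hp' : p ∈ bset D'.toDomains) : lam D ⟨p, hp⟩ = lam D' ⟨p, hp'⟩ := by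
  funext z
  simp only [lam_apply]
  by_cases hz : blkOf D.toDomains z = ⟨p, hp⟩
  · have hz' : blkOf D'.toDomains z = ⟨p, hp'⟩ := (blkOf_eq_iff_blkOf_eq D D' hp hp' z).1 hz
    simp [hz, hz']
  · have hz' : ¬ blkOf D'.toDomains z = ⟨p, hp'⟩ := fun h => hz ((blkOf_eq_iff_blkOf_eq D D' hp hp' z).2 h)
    simp [hz, hz']

/-- `Q′*φ = Σ_u φ(u)·λ_u` (block-constant extension). [cite: Balaban1984PropagatorsII, (2.69) p.235, p.248 («Q*»)] -/
theorem QsB_eq_sum_lam (D₀ : TDomains d ℓ Mh k P R) (φ : ↥(bset D₀.toDomains) → ℝ) :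
    QsB D₀.toDomains φ = ∑ u : ↥(bset D₀.toDomains), φ u • lam D₀ u := by
  funext z
  rw [QsB_apply, Finset.sum_apply, Finset.sum_eq_single (blkOf D₀.toDomains z)]
  · simp [lam_apply]
  · intro u _ hu
    simp [lam_apply, Ne.symm hu]
  · intro h; exact absurd (Finset.mem_univ _) h

/-- `(T·Q′*φ)(z) = Σ_u (Tλ_u)(z)·φ(u)` for a linear `T`. [cite: Balaban1984PropagatorsII, (2.52)–(2.55) p.232 («insert Σ_{y″}Δ(y″) = I»)] -/
theorem apply_QsB_eq_sum (D₀ : TDomains d ℓ Mh k P R) (T : Module.End ℝ (↥(boxDom (N0 ℓ Mh k P)) → ℝ))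
    (φ : ↥(bset D₀.toDomains) → ℝ) (z : ↥(boxDom (N0 ℓ Mh k P))) :
    T (QsB D₀.toDomains φ) z = ∑ u : ↥(bset D₀.toDomains), T (lam D₀ u) z * φ u := by
  rw [QsB_eq_sum_lam, map_sum, Finset.sum_apply]
  refine Finset.sum_congr rfl fun u _ => ?_
  rw [map_smul, Pi.smul_apply, smul_eq_mul, mul_comm]

/-- `(Sλ_v)(z) = Σ_{w∈B(v)} S(z, w)`. [cite: Balaban1984PropagatorsII, (2.51) p.232, dictionary] -/
theorem mulVec_lam (D₀ : TDomains d ℓ Mh k P R) (S : Matrix ↥(boxDom (N0 ℓ Mh k P)) ↥(boxDom (N0 ℓ Mh k P)) ℝ)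
    (v : ↥(bset D₀.toDomains)) (z : ↥(boxDom (N0 ℓ Mh k P))) :
    (S *ᵥ lam D₀ v) z = ∑ w ∈ Finset.univ.filter (fun w => blkOf D₀.toDomains w = v), S z w := by
  rw [Finset.sum_filter]
  simp only [Matrix.mulVec, dotProduct]
  refine Finset.sum_congr rfl fun w _ => ?_
  rw [lam_apply]
  split_ifs <;> simp

/-- `W(v)·(Q′f)(v) = (Sλ_v)(z′)` for the row `f = S(z′, ·)` (the block mean times the block volume).
[cite: Balaban1984PropagatorsII, (2.14)–(2.15) p.225, (2.69) p.235] -/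
theorem W_mul_QB_row (D₀ : TDomains d ℓ Mh k P R) (S : Matrix ↥(boxDom (N0 ℓ Mh k P)) ↥(boxDom (N0 ℓ Mh k P)) ℝ)
    (z' : ↥(boxDom (N0 ℓ Mh k P))) (v : ↥(bset D₀.toDomains)) :
    W D₀.toDomains v * QB D₀.toDomains (fun w => S z' w) v = (S *ᵥ lam D₀ v) z' := by
  rw [QB_apply, mulVec_lam, ← mul_assoc, mul_inv_cancel₀ (W_pos _ v).ne', one_mul]

/-- `((Q′G′²Q′*)⁻¹q)(u) = Σ_v C(u, v)·W(v)q(v)` with `C` the (2.69)-kernel `CinvT`. [cite: Balaban1984PropagatorsII, (2.69) p.235, Prop. 2.3 p.238] -/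
theorem GinvT_apply_eq_sum (D₀ : TDomains d ℓ Mh k P R) (a : ℕ → ℝ) (q : ↥(bset D₀.toDomains) → ℝ)
    (u : ↥(bset D₀.toDomains)) :
    GinvT D₀ a q u = ∑ v : ↥(bset D₀.toDomains), CinvT D₀ a u v * (W D₀.toDomains v * q v) := by
  rw [apply_eq_sum_mat]
  refine Finset.sum_congr rfl fun v _ => ?_
  have h := mat_GinvT_div D₀ a u v
  rw [div_eq_iff (W_pos _ v).ne'] at h
  rw [h]; ring

/-- **THE WORD IN BLOCK SUMS**: `(T·Q′*·(Q′G′²Q′*)⁻¹·Q′·S(z′, ·))(z) = Σ_{u,v∈𝔅} (Tλ_u)(z)·C(u, v)·(Sλ_v)(z′)` — the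
factorisation of `P = G′Q′*(Q′G′²Q′*)⁻¹Q′G′` and its derivatives through the blocks («using again Lemma 2.1»).
[cite: Balaban1985BackgroundPropagators, (3.25) p.394, (3.49) p.399; Balaban1984PropagatorsII, (2.17) p.225, (2.88) p.238] -/
theorem word_eq_sum (D₀ : TDomains d ℓ Mh k P R) (a : ℕ → ℝ) (T : Module.End ℝ (↥(boxDom (N0 ℓ Mh k P)) → ℝ))
    (S : Matrix ↥(boxDom (N0 ℓ Mh k P)) ↥(boxDom (N0 ℓ Mh k P)) ℝ) (z z' : ↥(boxDom (N0 ℓ Mh k P))) :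
    T (QsB D₀.toDomains (GinvT D₀ a (QB D₀.toDomains (fun w => S z' w)))) z
      = ∑ u : ↥(bset D₀.toDomains), T (lam D₀ u) z
          * ∑ v : ↥(bset D₀.toDomains), CinvT D₀ a u v * (S *ᵥ lam D₀ v) z' := by
  rw [apply_QsB_eq_sum]
  refine Finset.sum_congr rfl fun u _ => ?_
  rw [GinvT_apply_eq_sum]
  refine congrArg _ (Finset.sum_congr rfl fun v _ => ?_)
  rw [W_mul_QB_row]

/-- **RE-INDEXING OVER THE COMMON TOP BLOCKS**: a sum over the blocks of `𝔅[D]` that are top blocks of both families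
equals the same sum over `𝔅[D′]` (the identification `τ` of the common top blocks is a bijection onto its image).
[cite: Balaban1985BackgroundPropagators, Thm 3.14 p.427 («Ω = Ω_k ∩ Ω′_k»), dictionary] -/
theorem sum_cc_transfer (D D' : TDomains d ℓ Mh k P R) (φ : ℕ × (Fin (d + 1) → ℤ) → ℝ) :
    ∑ u : ↥(bset D.toDomains), (if u.1.1 = k ∧ u.1 ∈ bset D'.toDomains then φ u.1 else 0)
      = ∑ u' : ↥(bset D'.toDomains), (if u'.1.1 = k ∧ u'.1 ∈ bset D.toDomains then φ u'.1 else 0) := by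
  classical
  have h1 : ∑ u : ↥(bset D.toDomains), (if u.1.1 = k ∧ u.1 ∈ bset D'.toDomains then φ u.1 else 0)
      = ∑ p ∈ (bset D.toDomains).filter (fun p => p.1 = k ∧ p ∈ bset D'.toDomains), φ p := by
    rw [Finset.sum_filter]
    exact Finset.sum_coe_sort (bset D.toDomains) (fun p => if p.1 = k ∧ p ∈ bset D'.toDomains then φ p else 0)
  have h2 : ∑ u' : ↥(bset D'.toDomains), (if u'.1.1 = k ∧ u'.1 ∈ bset D.toDomains then φ u'.1 else 0)
      = ∑ p ∈ (bset D'.toDomains).filter (fun p => p.1 = k ∧ p ∈ bset D.toDomains), φ p := by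
    rw [Finset.sum_filter]
    exact Finset.sum_coe_sort (bset D'.toDomains) (fun p => if p.1 = k ∧ p ∈ bset D.toDomains then φ p else 0)
  have hS : (bset D.toDomains).filter (fun p => p.1 = k ∧ p ∈ bset D'.toDomains)
      = (bset D'.toDomains).filter (fun p => p.1 = k ∧ p ∈ bset D.toDomains) := by
    ext p
    simp only [Finset.mem_filter]
    tauto
  rw [h1, h2, hS]


/-- **THE TRANSFER-TELESCOPING IDENTITY, ABSTRACT VALUES**: for block functions `E, F` on `𝔅[D]`, `E′, F′` on `𝔅[D′]`,
kernels `C`, `C′`, and cross values `E″` (on `𝔅[D]`), `F̃` (on `𝔅[D′]`) that agree with `E′`, `F` on the common top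
blocks (identification `τ`), `Σ_u E(u)Σ_v C(u,v)F(v) − Σ_{u′}E′(u′)Σ_{v′}C′(u′,v′)F′(v′) = T_A + T_B + T_C` with
`T_A = Σ_u (E − τ*E′)(u)·(CF)(u)`, `T_B = Σ_{u′,v} E′(u′)·(τC − C′τ)(u′, v)·F(v)`, `T_C = Σ_{u′}(E′C′)(u′)·(τF − F′)(u′)` — pure
linearity; print's walk cancellation «in the difference all terms for walks with localizations contained in Ω are cancelled»
in resolvent form. [cite: Balaban1985BackgroundPropagators, Thm 3.14 p.427] -/
theorem telescope (D D' : TDomains d ℓ Mh k P R) (E E'' F : ↥(bset D.toDomains) → ℝ)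
    (E' Ft F' : ↥(bset D'.toDomains) → ℝ) (C : ↥(bset D.toDomains) → ↥(bset D.toDomains) → ℝ)
    (C' : ↥(bset D'.toDomains) → ↥(bset D'.toDomains) → ℝ)
    (hEE : ∀ (u : ↥(bset D.toDomains)) (h : u.1.1 = k ∧ u.1 ∈ bset D'.toDomains), E'' u = E' ⟨u.1, h.2⟩)
    (hFF : ∀ (u' : ↥(bset D'.toDomains)) (h : u'.1.1 = k ∧ u'.1 ∈ bset D.toDomains), Ft u' = F ⟨u'.1, h.2⟩) :
    (∑ u : ↥(bset D.toDomains), E u * ∑ v : ↥(bset D.toDomains), C u v * F v)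
      - (∑ u' : ↥(bset D'.toDomains), E' u' * ∑ v' : ↥(bset D'.toDomains), C' u' v' * F' v')
    = (∑ u : ↥(bset D.toDomains),
        (E u - (if u.1.1 = k ∧ u.1 ∈ bset D'.toDomains then E'' u else 0))
          * ∑ v : ↥(bset D.toDomains), C u v * F v)
      + (∑ u' : ↥(bset D'.toDomains), E' u' *
          ∑ v : ↥(bset D.toDomains),
            ((if h : u'.1.1 = k ∧ u'.1 ∈ bset D.toDomains then C ⟨u'.1, h.2⟩ v else 0)
              - (if h : v.1.1 = k ∧ v.1 ∈ bset D'.toDomains then C' u' ⟨v.1, h.2⟩ else 0)) * F v)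
      + ∑ u' : ↥(bset D'.toDomains),
          (∑ w' : ↥(bset D'.toDomains), E' w' * C' w' u')
            * ((if u'.1.1 = k ∧ u'.1 ∈ bset D.toDomains then Ft u' else 0) - F' u') := by
  classical
  -- X1: `Σ_u (τ*E′)(u)(CF)(u) = Σ_{u′} E′(u′) Σ_v (τC)(u′,v)F(v)`
  have X1 : ∑ u : ↥(bset D.toDomains), (if u.1.1 = k ∧ u.1 ∈ bset D'.toDomains then E'' u else 0)
        * ∑ v : ↥(bset D.toDomains), C u v * F v
      = ∑ u' : ↥(bset D'.toDomains), E' u' * ∑ v : ↥(bset D.toDomains),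
          (if h : u'.1.1 = k ∧ u'.1 ∈ bset D.toDomains then C ⟨u'.1, h.2⟩ v else 0) * F v := by
    have key := sum_cc_transfer D D' (fun p => if hp : p ∈ bset D.toDomains ∧ p ∈ bset D'.toDomains then
      E' ⟨p, hp.2⟩ * ∑ v : ↥(bset D.toDomains), C ⟨p, hp.1⟩ v * F v else 0)
    have lhs : ∀ u : ↥(bset D.toDomains),
        (if u.1.1 = k ∧ u.1 ∈ bset D'.toDomains then E'' u else 0) * ∑ v : ↥(bset D.toDomains), C u v * F v
          = (if u.1.1 = k ∧ u.1 ∈ bset D'.toDomains then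
              (if hp : u.1 ∈ bset D.toDomains ∧ u.1 ∈ bset D'.toDomains then
                E' ⟨u.1, hp.2⟩ * ∑ v : ↥(bset D.toDomains), C ⟨u.1, hp.1⟩ v * F v else 0) else 0) := by
      intro u
      by_cases hu : u.1.1 = k ∧ u.1 ∈ bset D'.toDomains
      · rw [if_pos hu, if_pos hu, dif_pos ⟨u.2, hu.2⟩, hEE u hu]
      · rw [if_neg hu, if_neg hu, zero_mul]
    have rhs : ∀ u' : ↥(bset D'.toDomains),
        E' u' * ∑ v : ↥(bset D.toDomains),
            (if h : u'.1.1 = k ∧ u'.1 ∈ bset D.toDomains then C ⟨u'.1, h.2⟩ v else 0) * F v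
          = (if u'.1.1 = k ∧ u'.1 ∈ bset D.toDomains then
              (if hp : u'.1 ∈ bset D.toDomains ∧ u'.1 ∈ bset D'.toDomains then
                E' ⟨u'.1, hp.2⟩ * ∑ v : ↥(bset D.toDomains), C ⟨u'.1, hp.1⟩ v * F v else 0) else 0) := by
      intro u'
      by_cases hu : u'.1.1 = k ∧ u'.1 ∈ bset D.toDomains
      · rw [if_pos hu, dif_pos ⟨hu.2, u'.2⟩]
        simp only [dif_pos hu]
      · rw [if_neg hu]
        simp only [dif_neg hu, zero_mul, Finset.sum_const_zero, mul_zero]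
    rw [Finset.sum_congr rfl fun u _ => lhs u, Finset.sum_congr rfl fun u' _ => rhs u']
    exact key
  -- X2: `Σ_{u′} E′(u′) Σ_v (C′τ)(u′,v)F(v) = Σ_{u′} (E′C′)(u′)·(τF)(u′)`
  have X2 : ∑ u' : ↥(bset D'.toDomains), E' u' * ∑ v : ↥(bset D.toDomains),
          (if h : v.1.1 = k ∧ v.1 ∈ bset D'.toDomains then C' u' ⟨v.1, h.2⟩ else 0) * F v
      = ∑ u' : ↥(bset D'.toDomains), (∑ w' : ↥(bset D'.toDomains), E' w' * C' w' u')
          * (if u'.1.1 = k ∧ u'.1 ∈ bset D.toDomains then Ft u' else 0) := by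
    have inner : ∀ w' : ↥(bset D'.toDomains),
        ∑ v : ↥(bset D.toDomains),
            (if h : v.1.1 = k ∧ v.1 ∈ bset D'.toDomains then C' w' ⟨v.1, h.2⟩ else 0) * F v
          = ∑ u' : ↥(bset D'.toDomains),
            (if u'.1.1 = k ∧ u'.1 ∈ bset D.toDomains then C' w' u' * Ft u' else 0) := by
      intro w'
      have key := sum_cc_transfer D D' (fun p => if hp : p ∈ bset D.toDomains ∧ p ∈ bset D'.toDomains then
        C' w' ⟨p, hp.2⟩ * F ⟨p, hp.1⟩ else 0)
      have lhs : ∀ v : ↥(bset D.toDomains),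
          (if h : v.1.1 = k ∧ v.1 ∈ bset D'.toDomains then C' w' ⟨v.1, h.2⟩ else 0) * F v
            = (if v.1.1 = k ∧ v.1 ∈ bset D'.toDomains then
                (if hp : v.1 ∈ bset D.toDomains ∧ v.1 ∈ bset D'.toDomains then
                  C' w' ⟨v.1, hp.2⟩ * F ⟨v.1, hp.1⟩ else 0) else 0) := by
        intro v
        by_cases hv : v.1.1 = k ∧ v.1 ∈ bset D'.toDomains
        · rw [dif_pos hv, if_pos hv, dif_pos ⟨v.2, hv.2⟩]
        · rw [dif_neg hv, if_neg hv, zero_mul]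
      have rhs : ∀ u' : ↥(bset D'.toDomains),
          (if u'.1.1 = k ∧ u'.1 ∈ bset D.toDomains then C' w' u' * Ft u' else 0)
            = (if u'.1.1 = k ∧ u'.1 ∈ bset D.toDomains then
                (if hp : u'.1 ∈ bset D.toDomains ∧ u'.1 ∈ bset D'.toDomains then
                  C' w' ⟨u'.1, hp.2⟩ * F ⟨u'.1, hp.1⟩ else 0) else 0) := by
        intro u'
        by_cases hu : u'.1.1 = k ∧ u'.1 ∈ bset D.toDomains
        · rw [if_pos hu, if_pos hu, dif_pos ⟨hu.2, u'.2⟩, hFF u' hu]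
        · rw [if_neg hu, if_neg hu]
      rw [Finset.sum_congr rfl fun v _ => lhs v, Finset.sum_congr rfl fun u' _ => rhs u']
      exact key
    calc ∑ u' : ↥(bset D'.toDomains), E' u' * ∑ v : ↥(bset D.toDomains),
            (if h : v.1.1 = k ∧ v.1 ∈ bset D'.toDomains then C' u' ⟨v.1, h.2⟩ else 0) * F v
        = ∑ w' : ↥(bset D'.toDomains), E' w' * ∑ u' : ↥(bset D'.toDomains),
            (if u'.1.1 = k ∧ u'.1 ∈ bset D.toDomains then C' w' u' * Ft u' else 0) :=
          Finset.sum_congr rfl fun w' _ => by rw [inner w']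
      _ = ∑ w' : ↥(bset D'.toDomains), ∑ u' : ↥(bset D'.toDomains),
            E' w' * C' w' u' * (if u'.1.1 = k ∧ u'.1 ∈ bset D.toDomains then Ft u' else 0) := by
          refine Finset.sum_congr rfl fun w' _ => ?_
          rw [Finset.mul_sum]
          refine Finset.sum_congr rfl fun u' _ => ?_
          split_ifs <;> ring
      _ = ∑ u' : ↥(bset D'.toDomains), ∑ w' : ↥(bset D'.toDomains),
            E' w' * C' w' u' * (if u'.1.1 = k ∧ u'.1 ∈ bset D.toDomains then Ft u' else 0) := Finset.sum_comm
      _ = _ := Finset.sum_congr rfl fun u' _ => by rw [Finset.sum_mul]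
  -- X3: `Σ_{u′}E′(u′)Σ_{v′}C′(u′,v′)F′(v′) = Σ_{u′}(E′C′)(u′)F′(u′)`
  have X3 : ∑ u' : ↥(bset D'.toDomains), E' u' * ∑ v' : ↥(bset D'.toDomains), C' u' v' * F' v'
      = ∑ u' : ↥(bset D'.toDomains), (∑ w' : ↥(bset D'.toDomains), E' w' * C' w' u') * F' u' := by
    calc ∑ u' : ↥(bset D'.toDomains), E' u' * ∑ v' : ↥(bset D'.toDomains), C' u' v' * F' v'
        = ∑ w' : ↥(bset D'.toDomains), ∑ u' : ↥(bset D'.toDomains), E' w' * C' w' u' * F' u' := by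
          refine Finset.sum_congr rfl fun w' _ => ?_
          rw [Finset.mul_sum]
          exact Finset.sum_congr rfl fun u' _ => by ring
      _ = ∑ u' : ↥(bset D'.toDomains), ∑ w' : ↥(bset D'.toDomains), E' w' * C' w' u' * F' u' := Finset.sum_comm
      _ = _ := Finset.sum_congr rfl fun u' _ => by rw [Finset.sum_mul]
  -- the three terms split
  have eA : ∑ u : ↥(bset D.toDomains),
        (E u - (if u.1.1 = k ∧ u.1 ∈ bset D'.toDomains then E'' u else 0))
          * ∑ v : ↥(bset D.toDomains), C u v * F v
      = (∑ u : ↥(bset D.toDomains), E u * ∑ v : ↥(bset D.toDomains), C u v * F v)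
        - ∑ u : ↥(bset D.toDomains), (if u.1.1 = k ∧ u.1 ∈ bset D'.toDomains then E'' u else 0)
          * ∑ v : ↥(bset D.toDomains), C u v * F v := by
    rw [← Finset.sum_sub_distrib]
    exact Finset.sum_congr rfl fun u _ => by ring
  have eB : ∑ u' : ↥(bset D'.toDomains), E' u' *
          ∑ v : ↥(bset D.toDomains),
            ((if h : u'.1.1 = k ∧ u'.1 ∈ bset D.toDomains then C ⟨u'.1, h.2⟩ v else 0)
              - (if h : v.1.1 = k ∧ v.1 ∈ bset D'.toDomains then C' u' ⟨v.1, h.2⟩ else 0)) * F v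
      = (∑ u' : ↥(bset D'.toDomains), E' u' * ∑ v : ↥(bset D.toDomains),
          (if h : u'.1.1 = k ∧ u'.1 ∈ bset D.toDomains then C ⟨u'.1, h.2⟩ v else 0) * F v)
        - ∑ u' : ↥(bset D'.toDomains), E' u' * ∑ v : ↥(bset D.toDomains),
          (if h : v.1.1 = k ∧ v.1 ∈ bset D'.toDomains then C' u' ⟨v.1, h.2⟩ else 0) * F v := by
    rw [← Finset.sum_sub_distrib]
    refine Finset.sum_congr rfl fun u' _ => ?_
    rw [← mul_sub, ← Finset.sum_sub_distrib]
    refine congrArg _ (Finset.sum_congr rfl fun v _ => ?_)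
    ring
  have eC : ∑ u' : ↥(bset D'.toDomains),
          (∑ w' : ↥(bset D'.toDomains), E' w' * C' w' u')
            * ((if u'.1.1 = k ∧ u'.1 ∈ bset D.toDomains then Ft u' else 0) - F' u')
      = (∑ u' : ↥(bset D'.toDomains), (∑ w' : ↥(bset D'.toDomains), E' w' * C' w' u')
            * (if u'.1.1 = k ∧ u'.1 ∈ bset D.toDomains then Ft u' else 0))
        - ∑ u' : ↥(bset D'.toDomains), (∑ w' : ↥(bset D'.toDomains), E' w' * C' w' u') * F' u' := by
    rw [← Finset.sum_sub_distrib]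
    exact Finset.sum_congr rfl fun u' _ => by ring
  rw [eA, eB, eC, X1, X2, X3]
  ring

/-- **THE TRANSFER-TELESCOPING IDENTITY FOR THE WORD `T·Q′*·(Q′G′²Q′*)⁻¹·Q′·S`** between the two families (the values
of `telescope`: `E(u) = (Tλ_u)(x)`, `E′(u′) = (T′λ′_{u′})(x)`, cross values `(T′λ_u)(x)` and `(Sλ′_{u′})(x′)` — on a common
block `λ_u = λ′_u`, `lam_common` —, `C = CinvT[D]`, `C′ = CinvT[D′]`, `F(v) = (Sλ_v)(x′)`, `F′(v′) = (S′λ′_{v′})(x′)`).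
[cite: Balaban1985BackgroundPropagators, Thm 3.14 p.427, (3.25) p.394; Balaban1984PropagatorsII, (2.17) p.225] -/
theorem word_sub_word (D D' : TDomains d ℓ Mh k P R) (a : ℕ → ℝ)
    (TL TL' : Module.End ℝ (↥(boxDom (N0 ℓ Mh k P)) → ℝ))
    (S S' : Matrix ↥(boxDom (N0 ℓ Mh k P)) ↥(boxDom (N0 ℓ Mh k P)) ℝ) (x x' : ↥(boxDom (N0 ℓ Mh k P))) :
    TL (QsB D.toDomains (GinvT D a (QB D.toDomains (fun w => S x' w)))) x
      - TL' (QsB D'.toDomains (GinvT D' a (QB D'.toDomains (fun w => S' x' w)))) x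
    = (∑ u : ↥(bset D.toDomains),
        (TL (lam D u) x - (if u.1.1 = k ∧ u.1 ∈ bset D'.toDomains then TL' (lam D u) x else 0))
          * ∑ v : ↥(bset D.toDomains), CinvT D a u v * (S *ᵥ lam D v) x')
      + (∑ u' : ↥(bset D'.toDomains), TL' (lam D' u') x *
          ∑ v : ↥(bset D.toDomains),
            ((if h : u'.1.1 = k ∧ u'.1 ∈ bset D.toDomains then CinvT D a ⟨u'.1, h.2⟩ v else 0)
              - (if h : v.1.1 = k ∧ v.1 ∈ bset D'.toDomains then CinvT D' a u' ⟨v.1, h.2⟩ else 0))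
            * (S *ᵥ lam D v) x')
      + ∑ u' : ↥(bset D'.toDomains),
          (∑ w' : ↥(bset D'.toDomains), TL' (lam D' w') x * CinvT D' a w' u')
            * ((if u'.1.1 = k ∧ u'.1 ∈ bset D.toDomains then (S *ᵥ lam D' u') x' else 0)
                - (S' *ᵥ lam D' u') x') := by
  rw [word_eq_sum, word_eq_sum]
  exact telescope D D' (fun u => TL (lam D u) x) (fun u => TL' (lam D u) x) (fun v => (S *ᵥ lam D v) x')
    (fun u' => TL' (lam D' u') x) (fun u' => (S *ᵥ lam D' u') x') (fun u' => (S' *ᵥ lam D' u') x')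
    (CinvT D a) (CinvT D' a)
    (fun u h => by simp only [lam_common D D' u.2 h.2])
    (fun u' h => by simp only [lam_common D D' h.2 u'.2])

end Expansion

/-! ## §3 The estimates of the three terms (legs by the torus (2.67), middle by (2.87)/(3.154), `Ωᶜ` witnesses, (2.60)
transfers at powers `4` and `d + 1`, (2.61) sums) -/

section Bounds

variable {ℓ Mh k R : ℕ} {P : Fin (d + 1) → ℕ} (D D' : TDomains d ℓ Mh k P R) (a : ℕ → ℝ)

omit D' in
/-- **THE INNER FACTOR `(C·F)(u) = Σ_v C(u, v)(Sλ_v)(x′)` OF TERM A**: with the (2.87) bound of `C = (Q′G′²Q′*)⁻¹[D]`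
((2.69)-normalised: `|C(u,v)| ≤ C_G·L^{−4j(u)}·W(v)⁻¹·e^{−δd(u,v)}`) and the (2.67)-type bound of the right letter at the top
block `y′ ∋ x′` (`|(Sλ_v)(x′)| ≤ C_E·L^{n_Rk}·e^{−δd(y′,v)}`):
`|(C·F)(u)| ≤ C_GC_Ec·L^{d+1}·L^{n_Rk}·L^{−4j(u)}·W(y′)⁻¹·e^{−½δd(u,y′)}` — the volume `W(v)⁻¹` rides to `W(y′)⁻¹` by
`transfer_W`, the chain `u → v → y′` by the triangle inequality, the sum by (2.61).
[cite: Balaban1985BackgroundPropagators, (3.49) p.399 («using again Lemma 2.1»); Balaban1984PropagatorsII, (2.87) p.238, (2.61) p.234] -/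
theorem inner_h_le (hMh : 1 ≤ Mh) (hP : ∀ μ, 1 ≤ P μ) (hRM : 1 ≤ R * ((ℓ + 1) * Mh))
    {S : Matrix ↥(boxDom (N0 ℓ Mh k P)) ↥(boxDom (N0 ℓ Mh k P)) ℝ} {x' : ↥(boxDom (N0 ℓ Mh k P))}
    {CE CG δ c : ℝ} {nR : ℕ} (hCE : 0 ≤ CE) (hCG : 0 ≤ CG) (hδ : 0 ≤ δ)
    {y' : ↥(bset D.toDomains)} (hy'k : y'.1.1 = k)
    (hF : ∀ s : ↥(bset D.toDomains), |(S *ᵥ lam D s) x'|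
      ≤ CE * ((ℓ : ℝ) + 1) ^ (nR * k) * Real.exp (-(δ * (geomT D).dist y' s)))
    (hC : ∀ u v : ↥(bset D.toDomains), |CinvT D a u v|
      ≤ CG * (((ℓ : ℝ) + 1) ^ (4 * u.1.1))⁻¹ * (W D.toDomains v)⁻¹ * Real.exp (-(δ * (geomT D).dist u v)))
    (hthrW : ((ℓ : ℝ) + 1) ^ (d + 1) ≤ Real.exp (δ / 4 * ((R : ℝ) * (((ℓ : ℝ) + 1) * Mh) - 1)))
    (h261 : Ineq261With c (geomT D) δ (1 / 4)) (u : ↥(bset D.toDomains)) :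
    |∑ v : ↥(bset D.toDomains), CinvT D a u v * (S *ᵥ lam D v) x'|
      ≤ CG * CE * c * ((ℓ : ℝ) + 1) ^ (d + 1) * ((ℓ : ℝ) + 1) ^ (nR * k) * (((ℓ : ℝ) + 1) ^ (4 * u.1.1))⁻¹
          * (W D.toDomains y')⁻¹ * Real.exp (-(δ / 2 * (geomT D).dist u y')) := by
  have hd0 : ∀ s t : ↥(bset D.toDomains), 0 ≤ (geomT D).dist s t := (triangle_refl_nonneg_T D hMh hP).2.2
  have htri : ∀ s t r : ↥(bset D.toDomains), (geomT D).dist s r ≤ (geomT D).dist s t + (geomT D).dist t r :=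
    (triangle_refl_nonneg_T D hMh hP).1
  have hc0 : 0 ≤ c := c261_nonneg D h261 y'
  have hWy : 0 < (W D.toDomains y')⁻¹ := inv_pos.2 (W_pos D.toDomains y')
  have hv : ∀ v : ↥(bset D.toDomains), |CinvT D a u v * (S *ᵥ lam D v) x'|
      ≤ CG * CE * ((ℓ : ℝ) + 1) ^ (d + 1) * ((ℓ : ℝ) + 1) ^ (nR * k) * (((ℓ : ℝ) + 1) ^ (4 * u.1.1))⁻¹
          * (W D.toDomains y')⁻¹ * Real.exp (-(δ / 2 * (geomT D).dist u y'))
          * Real.exp (-(δ / 4 * (geomT D).dist y' v)) := by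
    intro v
    have hWv : 0 < (W D.toDomains v)⁻¹ := inv_pos.2 (W_pos D.toDomains v)
    rw [abs_mul]
    have htr := transfer_W D hMh hP hRM (σ := δ / 4) (by positivity) hthrW v y' hy'k
    have hsplit : Real.exp (-(δ * (geomT D).dist u v)) * Real.exp (-(δ * (geomT D).dist y' v))
        = Real.exp (-(δ / 4 * (geomT D).dist y' v))
          * (Real.exp (-(δ * (geomT D).dist u v)) * Real.exp (-(3 * δ / 4 * (geomT D).dist y' v))) := by
      rw [← Real.exp_add, ← Real.exp_add, ← Real.exp_add]; congr 1; ring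
    have hexp : Real.exp (-(δ * (geomT D).dist u v)) * Real.exp (-(3 * δ / 4 * (geomT D).dist y' v))
        ≤ Real.exp (-(δ / 2 * (geomT D).dist u y')) * Real.exp (-(δ / 4 * (geomT D).dist y' v)) := by
      rw [← Real.exp_add, ← Real.exp_add, Real.exp_le_exp]
      have h1 := htri u v y'
      rw [symmT D v y'] at h1
      linarith [mul_le_mul_of_nonneg_left h1 hδ, mul_nonneg hδ (hd0 u v), mul_nonneg hδ (hd0 y' v)]
    calc |CinvT D a u v| * |(S *ᵥ lam D v) x'|
        ≤ (CG * (((ℓ : ℝ) + 1) ^ (4 * u.1.1))⁻¹ * (W D.toDomains v)⁻¹ * Real.exp (-(δ * (geomT D).dist u v)))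
            * (CE * ((ℓ : ℝ) + 1) ^ (nR * k) * Real.exp (-(δ * (geomT D).dist y' v))) :=
          mul_le_mul (hC u v) (hF v) (abs_nonneg _) (by positivity)
      _ = CG * CE * ((ℓ : ℝ) + 1) ^ (nR * k) * (((ℓ : ℝ) + 1) ^ (4 * u.1.1))⁻¹ * (W D.toDomains v)⁻¹
            * (Real.exp (-(δ * (geomT D).dist u v)) * Real.exp (-(δ * (geomT D).dist y' v))) := by ring
      _ = CG * CE * ((ℓ : ℝ) + 1) ^ (nR * k) * (((ℓ : ℝ) + 1) ^ (4 * u.1.1))⁻¹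
            * ((W D.toDomains v)⁻¹ * Real.exp (-(δ / 4 * (geomT D).dist y' v)))
            * (Real.exp (-(δ * (geomT D).dist u v)) * Real.exp (-(3 * δ / 4 * (geomT D).dist y' v))) := by
          rw [hsplit]; ring
      _ ≤ CG * CE * ((ℓ : ℝ) + 1) ^ (nR * k) * (((ℓ : ℝ) + 1) ^ (4 * u.1.1))⁻¹
            * (((ℓ : ℝ) + 1) ^ (d + 1) * (W D.toDomains y')⁻¹)
            * (Real.exp (-(δ / 2 * (geomT D).dist u y')) * Real.exp (-(δ / 4 * (geomT D).dist y' v))) :=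
          mul_le_mul (mul_le_mul_of_nonneg_left htr (by positivity)) hexp (by positivity) (by positivity)
      _ = _ := by ring
  calc |∑ v : ↥(bset D.toDomains), CinvT D a u v * (S *ᵥ lam D v) x'|
      ≤ ∑ v : ↥(bset D.toDomains), |CinvT D a u v * (S *ᵥ lam D v) x'| := Finset.abs_sum_le_sum_abs _ _
    _ ≤ ∑ v : ↥(bset D.toDomains), CG * CE * ((ℓ : ℝ) + 1) ^ (d + 1) * ((ℓ : ℝ) + 1) ^ (nR * k)
          * (((ℓ : ℝ) + 1) ^ (4 * u.1.1))⁻¹ * (W D.toDomains y')⁻¹ * Real.exp (-(δ / 2 * (geomT D).dist u y'))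
          * Real.exp (-(δ / 4 * (geomT D).dist y' v)) := Finset.sum_le_sum fun v _ => hv v
    _ = CG * CE * ((ℓ : ℝ) + 1) ^ (d + 1) * ((ℓ : ℝ) + 1) ^ (nR * k)
          * (((ℓ : ℝ) + 1) ^ (4 * u.1.1))⁻¹ * (W D.toDomains y')⁻¹ * Real.exp (-(δ / 2 * (geomT D).dist u y'))
          * ∑ v : ↥(bset D.toDomains), Real.exp (-(δ / 4 * (geomT D).dist y' v)) := by rw [Finset.mul_sum]
    _ ≤ CG * CE * ((ℓ : ℝ) + 1) ^ (d + 1) * ((ℓ : ℝ) + 1) ^ (nR * k)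
          * (((ℓ : ℝ) + 1) ^ (4 * u.1.1))⁻¹ * (W D.toDomains y')⁻¹ * Real.exp (-(δ / 2 * (geomT D).dist u y')) * c :=
        mul_le_mul_of_nonneg_left (sum_exp_le D h261 y') (by positivity)
    _ = _ := by ring


/-- **TERM A, ONE BLOCK `u ∈ 𝔅[D]`**: `|(E − τ*E′)(u)|·|(C·F)(u)| ≤ K_A·Λ·e^{−¼δd(y,y′,Ω)}·e^{−¼δd_D(u,y′)}` with
`Λ = L^{n_Lk}L^{n_Rk}L^{−4k}W(y′)⁻¹`, `K_A = (C_Δ + C_EL⁴e^{δ/2})·C_GC_Ec·L^{d+1}`: if `u` is a common top block the first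
factor is the two-family difference of the left letter (`≤ C_ΔL^{n_Lk}e^{−δd(y,u,Ω)}`) and `d(y,y′,Ω) ≤ d(y,u,Ω) + |u − y′|`;
otherwise `u` meets `Ωᶜ` (`exists_OmegaC_of_not_common'`), the single-family letter carries `e^{−δd_D(y,u)}`, the scale
mismatch `L^{4k}/L^{4j(u)}` is paid by (2.60) (`transfer_four`) and §1's witness inequality gives the (3.154) factor.
[cite: Balaban1985BackgroundPropagators, Thm 3.14 (3.154) pp.426–427, (3.49) p.399; Balaban1984PropagatorsII, (2.60) p.234, (2.87) p.238] -/
theorem termA_le (hMh : 1 ≤ Mh) (hP : ∀ μ, 1 ≤ P μ) (hRM : 1 ≤ R * ((ℓ + 1) * Mh))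
    {TL TL' : Module.End ℝ (↥(boxDom (N0 ℓ Mh k P)) → ℝ)}
    {S : Matrix ↥(boxDom (N0 ℓ Mh k P)) ↥(boxDom (N0 ℓ Mh k P)) ℝ} {x x' : ↥(boxDom (N0 ℓ Mh k P))}
    {CE CG CΔ δ c : ℝ} {nL nR : ℕ} (hCE : 0 ≤ CE) (hCG : 0 ≤ CG) (hCΔ : 0 ≤ CΔ) (hδ : 0 ≤ δ)
    {y y' : ↥(bset D.toDomains)} (hy : y.1.1 = k ∧ y.1 ∈ bset D'.toDomains)
    (hy' : y'.1.1 = k ∧ y'.1 ∈ bset D'.toDomains)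
    (hE : ∀ s : ↥(bset D.toDomains), |TL (lam D s) x|
      ≤ CE * ((ℓ : ℝ) + 1) ^ (nL * k) * Real.exp (-(δ * (geomT D).dist y s)))
    (hF : ∀ s : ↥(bset D.toDomains), |(S *ᵥ lam D s) x'|
      ≤ CE * ((ℓ : ℝ) + 1) ^ (nR * k) * Real.exp (-(δ * (geomT D).dist y' s)))
    (hC : ∀ u v : ↥(bset D.toDomains), |CinvT D a u v|
      ≤ CG * (((ℓ : ℝ) + 1) ^ (4 * u.1.1))⁻¹ * (W D.toDomains v)⁻¹ * Real.exp (-(δ * (geomT D).dist u v)))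
    (hΔE : ∀ u : ↥(bset D.toDomains), u.1.1 = k ∧ u.1 ∈ bset D'.toDomains →
      |TL (lam D u) x - TL' (lam D u) x| ≤ CΔ * ((ℓ : ℝ) + 1) ^ (nL * k) * Real.exp (-(δ * dOmega D D' y.1.2 u.1.2)))
    (hthr2 : ((ℓ : ℝ) + 1) ^ 2 ≤ Real.exp (1 / 4 * (δ / 2) * ((R : ℝ) * (((ℓ : ℝ) + 1) * Mh) - 1)))
    (hthrW : ((ℓ : ℝ) + 1) ^ (d + 1) ≤ Real.exp (δ / 4 * ((R : ℝ) * (((ℓ : ℝ) + 1) * Mh) - 1)))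
    (h261 : Ineq261With c (geomT D) δ (1 / 4)) (u : ↥(bset D.toDomains)) :
    |TL (lam D u) x - (if u.1.1 = k ∧ u.1 ∈ bset D'.toDomains then TL' (lam D u) x else 0)|
        * |∑ v : ↥(bset D.toDomains), CinvT D a u v * (S *ᵥ lam D v) x'|
      ≤ (CΔ + CE * ((ℓ : ℝ) + 1) ^ 4 * Real.exp (δ / 2)) * (CG * CE * c * ((ℓ : ℝ) + 1) ^ (d + 1))
          * (((ℓ : ℝ) + 1) ^ (nL * k) * ((ℓ : ℝ) + 1) ^ (nR * k) * (((ℓ : ℝ) + 1) ^ (4 * k))⁻¹ * (W D.toDomains y')⁻¹)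
          * Real.exp (-(δ / 4 * dOmega D D' y.1.2 y'.1.2)) * Real.exp (-(δ / 4 * (geomT D).dist u y')) := by
  have hL1 : (1 : ℝ) ≤ (ℓ : ℝ) + 1 := by linarith [(Nat.cast_nonneg ℓ : (0 : ℝ) ≤ ℓ)]
  have hL0 : (0 : ℝ) < (ℓ : ℝ) + 1 := by positivity
  have hd0 : ∀ s t : ↥(bset D.toDomains), 0 ≤ (geomT D).dist s t := (triangle_refl_nonneg_T D hMh hP).2.2
  have hΩ0 : ∀ β β', 0 ≤ dOmega D D' β β' := dOmega_nonneg D D'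
  have hc0 : 0 ≤ c := c261_nonneg D h261 y'
  have hWy : 0 < (W D.toDomains y')⁻¹ := inv_pos.2 (W_pos D.toDomains y')
  have hL4k0 : (0 : ℝ) < ((ℓ : ℝ) + 1) ^ (4 * k) := by positivity
  have hh := inner_h_le D a hMh hP hRM hCE hCG hδ hy'.1 hF hC hthrW h261 u
  -- the final shape is monotone in the middle constant
  have hZ0 : 0 ≤ (CG * CE * c * ((ℓ : ℝ) + 1) ^ (d + 1))
      * (((ℓ : ℝ) + 1) ^ (nL * k) * ((ℓ : ℝ) + 1) ^ (nR * k) * (((ℓ : ℝ) + 1) ^ (4 * k))⁻¹ * (W D.toDomains y')⁻¹)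
      * Real.exp (-(δ / 4 * dOmega D D' y.1.2 y'.1.2)) * Real.exp (-(δ / 4 * (geomT D).dist u y')) := by positivity
  have hshape : ∀ {K : ℝ}, K ≤ CΔ + CE * ((ℓ : ℝ) + 1) ^ 4 * Real.exp (δ / 2) →
      K * (CG * CE * c * ((ℓ : ℝ) + 1) ^ (d + 1))
        * (((ℓ : ℝ) + 1) ^ (nL * k) * ((ℓ : ℝ) + 1) ^ (nR * k) * (((ℓ : ℝ) + 1) ^ (4 * k))⁻¹ * (W D.toDomains y')⁻¹)
        * Real.exp (-(δ / 4 * dOmega D D' y.1.2 y'.1.2)) * Real.exp (-(δ / 4 * (geomT D).dist u y'))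
      ≤ (CΔ + CE * ((ℓ : ℝ) + 1) ^ 4 * Real.exp (δ / 2)) * (CG * CE * c * ((ℓ : ℝ) + 1) ^ (d + 1))
        * (((ℓ : ℝ) + 1) ^ (nL * k) * ((ℓ : ℝ) + 1) ^ (nR * k) * (((ℓ : ℝ) + 1) ^ (4 * k))⁻¹ * (W D.toDomains y')⁻¹)
        * Real.exp (-(δ / 4 * dOmega D D' y.1.2 y'.1.2)) * Real.exp (-(δ / 4 * (geomT D).dist u y')) := by
    intro K hK
    have := mul_le_mul_of_nonneg_right hK hZ0
    calc _ = K * ((CG * CE * c * ((ℓ : ℝ) + 1) ^ (d + 1))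
        * (((ℓ : ℝ) + 1) ^ (nL * k) * ((ℓ : ℝ) + 1) ^ (nR * k) * (((ℓ : ℝ) + 1) ^ (4 * k))⁻¹ * (W D.toDomains y')⁻¹)
        * Real.exp (-(δ / 4 * dOmega D D' y.1.2 y'.1.2)) * Real.exp (-(δ / 4 * (geomT D).dist u y'))) := by ring
      _ ≤ _ := this
      _ = _ := by ring
  by_cases hu : u.1.1 = k ∧ u.1 ∈ bset D'.toDomains
  · -- `u` common top: the two-family difference of the left letter
    rw [if_pos hu]
    have hA := hΔE u hu
    have hhk : |∑ v : ↥(bset D.toDomains), CinvT D a u v * (S *ᵥ lam D v) x'|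
        ≤ CG * CE * c * ((ℓ : ℝ) + 1) ^ (d + 1) * ((ℓ : ℝ) + 1) ^ (nR * k) * (((ℓ : ℝ) + 1) ^ (4 * k))⁻¹
          * (W D.toDomains y')⁻¹ * Real.exp (-(δ / 2 * (geomT D).dist u y')) := by
      rw [hu.1] at hh; exact hh
    -- geometry: `d(y,y′,Ω) ≤ d(y,u,Ω) + d_D(u,y′)`
    have ht := tdistK_le_distT_of_top D hMh hP hu.1 hy'.1
    have h1 := dOmega_le_add_tdistK D D' y.1.2 u.1.2 y'.1.2
    have hgeo : dOmega D D' y.1.2 y'.1.2 ≤ dOmega D D' y.1.2 u.1.2 + (geomT D).dist u y' := by linarith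
    have hexp : Real.exp (-(δ * dOmega D D' y.1.2 u.1.2)) * Real.exp (-(δ / 2 * (geomT D).dist u y'))
        ≤ Real.exp (-(δ / 4 * dOmega D D' y.1.2 y'.1.2)) * Real.exp (-(δ / 4 * (geomT D).dist u y')) := by
      rw [← Real.exp_add, ← Real.exp_add, Real.exp_le_exp]
      have hA0 := hΩ0 y.1.2 u.1.2
      have hB0 := hd0 u y'
      linarith [mul_le_mul_of_nonneg_left hgeo hδ, mul_nonneg hδ hA0, mul_nonneg hδ hB0]
    calc |TL (lam D u) x - TL' (lam D u) x| * |∑ v : ↥(bset D.toDomains), CinvT D a u v * (S *ᵥ lam D v) x'|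
        ≤ (CΔ * ((ℓ : ℝ) + 1) ^ (nL * k) * Real.exp (-(δ * dOmega D D' y.1.2 u.1.2)))
          * (CG * CE * c * ((ℓ : ℝ) + 1) ^ (d + 1) * ((ℓ : ℝ) + 1) ^ (nR * k) * (((ℓ : ℝ) + 1) ^ (4 * k))⁻¹
            * (W D.toDomains y')⁻¹ * Real.exp (-(δ / 2 * (geomT D).dist u y'))) :=
          mul_le_mul hA hhk (abs_nonneg _) (by positivity)
      _ = CΔ * (CG * CE * c * ((ℓ : ℝ) + 1) ^ (d + 1))
          * (((ℓ : ℝ) + 1) ^ (nL * k) * ((ℓ : ℝ) + 1) ^ (nR * k) * (((ℓ : ℝ) + 1) ^ (4 * k))⁻¹ * (W D.toDomains y')⁻¹)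
          * (Real.exp (-(δ * dOmega D D' y.1.2 u.1.2)) * Real.exp (-(δ / 2 * (geomT D).dist u y'))) := by ring
      _ ≤ CΔ * (CG * CE * c * ((ℓ : ℝ) + 1) ^ (d + 1))
          * (((ℓ : ℝ) + 1) ^ (nL * k) * ((ℓ : ℝ) + 1) ^ (nR * k) * (((ℓ : ℝ) + 1) ^ (4 * k))⁻¹ * (W D.toDomains y')⁻¹)
          * (Real.exp (-(δ / 4 * dOmega D D' y.1.2 y'.1.2)) * Real.exp (-(δ / 4 * (geomT D).dist u y'))) :=
          mul_le_mul_of_nonneg_left hexp (by positivity)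
      _ = CΔ * (CG * CE * c * ((ℓ : ℝ) + 1) ^ (d + 1))
          * (((ℓ : ℝ) + 1) ^ (nL * k) * ((ℓ : ℝ) + 1) ^ (nR * k) * (((ℓ : ℝ) + 1) ^ (4 * k))⁻¹ * (W D.toDomains y')⁻¹)
          * Real.exp (-(δ / 4 * dOmega D D' y.1.2 y'.1.2)) * Real.exp (-(δ / 4 * (geomT D).dist u y')) := by ring
      _ ≤ _ := hshape (le_add_of_nonneg_right (by positivity))
  · -- `u` not common top: single-family letter, witness in `u`, scale transfer
    rw [if_neg hu, sub_zero]
    have hA := hE u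
    obtain ⟨z, hz, hzΩ⟩ := exists_OmegaC_of_not_common' D D' u hu
    have hw := dOmega_le_of_witness' D D' D hMh hP (y₀ := y) (b := u) (y₀' := y') hy.1 hy'.1 hz hzΩ
    have htr := transfer_four D hMh hP hRM (δ := δ / 2) (by positivity) hthr2 u y hy.1
    have hsplit : Real.exp (-(δ * (geomT D).dist y u))
        = Real.exp (-(δ / 2 / 2 * (geomT D).dist y u)) * Real.exp (-(3 * δ / 4 * (geomT D).dist y u)) := by
      rw [← Real.exp_add]; congr 1; ring
    have hexp : Real.exp (-(3 * δ / 4 * (geomT D).dist y u)) * Real.exp (-(δ / 2 * (geomT D).dist u y'))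
        ≤ Real.exp (δ / 2) * Real.exp (-(δ / 4 * dOmega D D' y.1.2 y'.1.2))
          * Real.exp (-(δ / 4 * (geomT D).dist u y')) := by
      rw [← Real.exp_add, ← Real.exp_add, ← Real.exp_add, Real.exp_le_exp]
      linarith [mul_le_mul_of_nonneg_left hw hδ, mul_nonneg hδ (hd0 y u), mul_nonneg hδ (hd0 u y')]
    have hu0 : 0 < ((ℓ : ℝ) + 1) ^ (4 * u.1.1) := by positivity
    have e1 : (((ℓ : ℝ) + 1) ^ (4 * u.1.1))⁻¹
        = (((ℓ : ℝ) + 1) ^ (4 * k))⁻¹ * (((ℓ : ℝ) + 1) ^ (4 * k) * (((ℓ : ℝ) + 1) ^ (4 * u.1.1))⁻¹) := by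
      rw [← mul_assoc, inv_mul_cancel₀ hL4k0.ne', one_mul]
    rw [e1] at hh
    calc |TL (lam D u) x| * |∑ v : ↥(bset D.toDomains), CinvT D a u v * (S *ᵥ lam D v) x'|
        ≤ (CE * ((ℓ : ℝ) + 1) ^ (nL * k) * Real.exp (-(δ * (geomT D).dist y u)))
          * (CG * CE * c * ((ℓ : ℝ) + 1) ^ (d + 1) * ((ℓ : ℝ) + 1) ^ (nR * k)
            * ((((ℓ : ℝ) + 1) ^ (4 * k))⁻¹ * (((ℓ : ℝ) + 1) ^ (4 * k) * (((ℓ : ℝ) + 1) ^ (4 * u.1.1))⁻¹))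
            * (W D.toDomains y')⁻¹ * Real.exp (-(δ / 2 * (geomT D).dist u y'))) :=
          mul_le_mul hA hh (abs_nonneg _) (by positivity)
      _ = CE * (CG * CE * c * ((ℓ : ℝ) + 1) ^ (d + 1))
          * (((ℓ : ℝ) + 1) ^ (nL * k) * ((ℓ : ℝ) + 1) ^ (nR * k) * (((ℓ : ℝ) + 1) ^ (4 * k))⁻¹ * (W D.toDomains y')⁻¹)
          * ((((ℓ : ℝ) + 1) ^ (4 * k) * (((ℓ : ℝ) + 1) ^ (4 * u.1.1))⁻¹ * Real.exp (-(δ / 2 / 2 * (geomT D).dist y u)))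
            * (Real.exp (-(3 * δ / 4 * (geomT D).dist y u)) * Real.exp (-(δ / 2 * (geomT D).dist u y')))) := by
          rw [hsplit]; ring
      _ ≤ CE * (CG * CE * c * ((ℓ : ℝ) + 1) ^ (d + 1))
          * (((ℓ : ℝ) + 1) ^ (nL * k) * ((ℓ : ℝ) + 1) ^ (nR * k) * (((ℓ : ℝ) + 1) ^ (4 * k))⁻¹ * (W D.toDomains y')⁻¹)
          * (((ℓ : ℝ) + 1) ^ 4 * (Real.exp (δ / 2) * Real.exp (-(δ / 4 * dOmega D D' y.1.2 y'.1.2))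
            * Real.exp (-(δ / 4 * (geomT D).dist u y')))) := by
          refine mul_le_mul_of_nonneg_left ?_ (by positivity)
          exact mul_le_mul htr hexp (by positivity) (by positivity)
      _ = (CE * ((ℓ : ℝ) + 1) ^ 4 * Real.exp (δ / 2)) * (CG * CE * c * ((ℓ : ℝ) + 1) ^ (d + 1))
          * (((ℓ : ℝ) + 1) ^ (nL * k) * ((ℓ : ℝ) + 1) ^ (nR * k) * (((ℓ : ℝ) + 1) ^ (4 * k))⁻¹ * (W D.toDomains y')⁻¹)
          * Real.exp (-(δ / 4 * dOmega D D' y.1.2 y'.1.2)) * Real.exp (-(δ / 4 * (geomT D).dist u y')) := by ring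
      _ ≤ _ := hshape (le_add_of_nonneg_left hCΔ)


/-- **TERM B, ONE PAIR `(u′, v) ∈ 𝔅[D′] × 𝔅[D]`**: `|E′(u′)|·|(τC − C′τ)(u′, v)|·|F(v)| ≤
K_B·Λ·e^{−½δd(y,y′,Ω)}·e^{−¼δd_{D′}(y,u′)}·e^{−¼δd_D(y′,v)}`, `K_B = C_E²(C_Δ + C_GL^{d+1} + C_GL⁴)e^{δ}` — the four cases of
file 2's `term_le` with the (2.69)-kernels of `(Q′G′²Q′*)⁻¹` in the middle: both common top ⇒ file 3's difference
(`≤ C_ΔL^{−4k}((L^k)^{d+1})⁻¹e^{−δd(u′,v,Ω)}`); exactly one ⇒ the other block meets `Ωᶜ`, the volume `W(v)⁻¹` or the scale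
`L^{−4j(u′)}` rides to the top by (2.60) (`transfer_W`, `transfer_four`), §1's witness inequality gives (3.154); neither ⇒ `0`.
[cite: Balaban1985BackgroundPropagators, Thm 3.14 (3.154) pp.426–427, Thm 3.2 (3.48) p.398; Balaban1984PropagatorsII, (2.87) p.238, (2.60) p.234] -/
theorem termB_le (hMh : 1 ≤ Mh) (hP : ∀ μ, 1 ≤ P μ) (hRM : 1 ≤ R * ((ℓ + 1) * Mh))
    {TL' : Module.End ℝ (↥(boxDom (N0 ℓ Mh k P)) → ℝ)}
    {S : Matrix ↥(boxDom (N0 ℓ Mh k P)) ↥(boxDom (N0 ℓ Mh k P)) ℝ} {x x' : ↥(boxDom (N0 ℓ Mh k P))}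
    {CE CG CΔ δ : ℝ} {nL nR : ℕ} (hCE : 0 ≤ CE) (hCG : 0 ≤ CG) (hCΔ : 0 ≤ CΔ) (hδ : 0 ≤ δ)
    {y y' : ↥(bset D.toDomains)} (hy : y.1.1 = k ∧ y.1 ∈ bset D'.toDomains)
    (hy' : y'.1.1 = k ∧ y'.1 ∈ bset D'.toDomains)
    (hE' : ∀ s' : ↥(bset D'.toDomains), |TL' (lam D' s') x|
      ≤ CE * ((ℓ : ℝ) + 1) ^ (nL * k) * Real.exp (-(δ * (geomT D').dist ⟨y.1, hy.2⟩ s')))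
    (hF : ∀ s : ↥(bset D.toDomains), |(S *ᵥ lam D s) x'|
      ≤ CE * ((ℓ : ℝ) + 1) ^ (nR * k) * Real.exp (-(δ * (geomT D).dist y' s)))
    (hC : ∀ u v : ↥(bset D.toDomains), |CinvT D a u v|
      ≤ CG * (((ℓ : ℝ) + 1) ^ (4 * u.1.1))⁻¹ * (W D.toDomains v)⁻¹ * Real.exp (-(δ * (geomT D).dist u v)))
    (hC' : ∀ u' v' : ↥(bset D'.toDomains), |CinvT D' a u' v'|
      ≤ CG * (((ℓ : ℝ) + 1) ^ (4 * u'.1.1))⁻¹ * (W D'.toDomains v')⁻¹ * Real.exp (-(δ * (geomT D').dist u' v')))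
    (hΔC : ∀ (u' : ↥(bset D'.toDomains)) (v : ↥(bset D.toDomains)) (hu' : u'.1.1 = k ∧ u'.1 ∈ bset D.toDomains)
      (hv : v.1.1 = k ∧ v.1 ∈ bset D'.toDomains),
      |CinvT D a ⟨u'.1, hu'.2⟩ v - CinvT D' a u' ⟨v.1, hv.2⟩|
        ≤ CΔ * (((ℓ : ℝ) + 1) ^ (4 * k))⁻¹ * ((((ℓ : ℝ) + 1) ^ k) ^ (d + 1))⁻¹
          * Real.exp (-(δ * dOmega D D' u'.1.2 v.1.2)))
    (hthr2 : ((ℓ : ℝ) + 1) ^ 2 ≤ Real.exp (1 / 4 * (δ / 2) * ((R : ℝ) * (((ℓ : ℝ) + 1) * Mh) - 1)))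
    (hthrW : ((ℓ : ℝ) + 1) ^ (d + 1) ≤ Real.exp (δ / 4 * ((R : ℝ) * (((ℓ : ℝ) + 1) * Mh) - 1)))
    (u' : ↥(bset D'.toDomains)) (v : ↥(bset D.toDomains)) :
    |TL' (lam D' u') x|
        * |(if h : u'.1.1 = k ∧ u'.1 ∈ bset D.toDomains then CinvT D a ⟨u'.1, h.2⟩ v else 0)
            - (if h : v.1.1 = k ∧ v.1 ∈ bset D'.toDomains then CinvT D' a u' ⟨v.1, h.2⟩ else 0)|
        * |(S *ᵥ lam D v) x'|
      ≤ CE ^ 2 * (CΔ + CG * ((ℓ : ℝ) + 1) ^ (d + 1) + CG * ((ℓ : ℝ) + 1) ^ 4) * Real.exp δ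
          * (((ℓ : ℝ) + 1) ^ (nL * k) * ((ℓ : ℝ) + 1) ^ (nR * k) * (((ℓ : ℝ) + 1) ^ (4 * k))⁻¹ * (W D.toDomains y')⁻¹)
          * Real.exp (-(δ / 2 * dOmega D D' y.1.2 y'.1.2))
          * (Real.exp (-(δ / 4 * (geomT D').dist ⟨y.1, hy.2⟩ u')) * Real.exp (-(δ / 4 * (geomT D).dist y' v))) := by
  have hL1 : (1 : ℝ) ≤ (ℓ : ℝ) + 1 := by linarith [(Nat.cast_nonneg ℓ : (0 : ℝ) ≤ ℓ)]
  have hL0 : (0 : ℝ) < (ℓ : ℝ) + 1 := by positivity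
  have hd0 : ∀ s t : ↥(bset D.toDomains), 0 ≤ (geomT D).dist s t := (triangle_refl_nonneg_T D hMh hP).2.2
  have hd0' : ∀ s t : ↥(bset D'.toDomains), 0 ≤ (geomT D').dist s t := (triangle_refl_nonneg_T D' hMh hP).2.2
  have hΩ0 : ∀ β β', 0 ≤ dOmega D D' β β' := dOmega_nonneg D D'
  have hWy : 0 < (W D.toDomains y')⁻¹ := inv_pos.2 (W_pos D.toDomains y')
  have hWyk : (W D.toDomains y')⁻¹ = ((((ℓ : ℝ) + 1) ^ k) ^ (d + 1))⁻¹ := by rw [W_eq, hy'.1]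
  have hL4k0 : (0 : ℝ) < ((ℓ : ℝ) + 1) ^ (4 * k) := by positivity
  have hEu := hE' u'
  have hFv := hF v
  -- the final shape is monotone in the middle constant
  have hZ0 : 0 ≤ CE ^ 2 * Real.exp δ
      * (((ℓ : ℝ) + 1) ^ (nL * k) * ((ℓ : ℝ) + 1) ^ (nR * k) * (((ℓ : ℝ) + 1) ^ (4 * k))⁻¹ * (W D.toDomains y')⁻¹)
      * Real.exp (-(δ / 2 * dOmega D D' y.1.2 y'.1.2))
      * (Real.exp (-(δ / 4 * (geomT D').dist ⟨y.1, hy.2⟩ u')) * Real.exp (-(δ / 4 * (geomT D).dist y' v))) := by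
    positivity
  have hshape : ∀ {K : ℝ}, K ≤ CΔ + CG * ((ℓ : ℝ) + 1) ^ (d + 1) + CG * ((ℓ : ℝ) + 1) ^ 4 →
      CE ^ 2 * K * Real.exp δ
        * (((ℓ : ℝ) + 1) ^ (nL * k) * ((ℓ : ℝ) + 1) ^ (nR * k) * (((ℓ : ℝ) + 1) ^ (4 * k))⁻¹ * (W D.toDomains y')⁻¹)
        * Real.exp (-(δ / 2 * dOmega D D' y.1.2 y'.1.2))
        * (Real.exp (-(δ / 4 * (geomT D').dist ⟨y.1, hy.2⟩ u')) * Real.exp (-(δ / 4 * (geomT D).dist y' v)))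
      ≤ CE ^ 2 * (CΔ + CG * ((ℓ : ℝ) + 1) ^ (d + 1) + CG * ((ℓ : ℝ) + 1) ^ 4) * Real.exp δ
        * (((ℓ : ℝ) + 1) ^ (nL * k) * ((ℓ : ℝ) + 1) ^ (nR * k) * (((ℓ : ℝ) + 1) ^ (4 * k))⁻¹ * (W D.toDomains y')⁻¹)
        * Real.exp (-(δ / 2 * dOmega D D' y.1.2 y'.1.2))
        * (Real.exp (-(δ / 4 * (geomT D').dist ⟨y.1, hy.2⟩ u')) * Real.exp (-(δ / 4 * (geomT D).dist y' v))) := by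
    intro K hK
    have := mul_le_mul_of_nonneg_right hK hZ0
    calc _ = K * (CE ^ 2 * Real.exp δ
        * (((ℓ : ℝ) + 1) ^ (nL * k) * ((ℓ : ℝ) + 1) ^ (nR * k) * (((ℓ : ℝ) + 1) ^ (4 * k))⁻¹ * (W D.toDomains y')⁻¹)
        * Real.exp (-(δ / 2 * dOmega D D' y.1.2 y'.1.2))
        * (Real.exp (-(δ / 4 * (geomT D').dist ⟨y.1, hy.2⟩ u')) * Real.exp (-(δ / 4 * (geomT D).dist y' v)))) := by
          ring
      _ ≤ _ := this
      _ = _ := by ring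
  -- the three middle constants against `K_B`
  have hLd : 0 ≤ CG * ((ℓ : ℝ) + 1) ^ (d + 1) := by positivity
  have hL4 : 0 ≤ CG * ((ℓ : ℝ) + 1) ^ 4 := by positivity
  have hK1 : CΔ ≤ CΔ + CG * ((ℓ : ℝ) + 1) ^ (d + 1) + CG * ((ℓ : ℝ) + 1) ^ 4 := by linarith
  have hK2 : CG * ((ℓ : ℝ) + 1) ^ (d + 1) ≤ CΔ + CG * ((ℓ : ℝ) + 1) ^ (d + 1) + CG * ((ℓ : ℝ) + 1) ^ 4 := by linarith
  have hK3 : CG * ((ℓ : ℝ) + 1) ^ 4 ≤ CΔ + CG * ((ℓ : ℝ) + 1) ^ (d + 1) + CG * ((ℓ : ℝ) + 1) ^ 4 := by linarith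
  by_cases hu : u'.1.1 = k ∧ u'.1 ∈ bset D.toDomains <;> by_cases hv : v.1.1 = k ∧ v.1 ∈ bset D'.toDomains
  · -- both common top: file 3's difference in the middle
    rw [dif_pos hu, dif_pos hv]
    have hM := hΔC u' v hu hv
    rw [← hWyk] at hM
    have ht1 := tdistK_le_distT_of_top D' hMh hP (y := ⟨y.1, hy.2⟩) (u := u') hy.1 hu.1
    have ht2 := tdistK_le_distT_of_top D hMh hP hv.1 hy'.1
    have h1 := dOmega_le_tdistK_add D D' y.1.2 u'.1.2 y'.1.2
    have h2 := dOmega_le_add_tdistK D D' u'.1.2 v.1.2 y'.1.2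
    have hsv := symmT D v y'
    have hΩ : dOmega D D' y.1.2 y'.1.2
        ≤ (geomT D').dist ⟨y.1, hy.2⟩ u' + dOmega D D' u'.1.2 v.1.2 + (geomT D).dist y' v := by
      have e : tdistK (ℓ := ℓ) (Mh := Mh) (k := k) (P := P) (⟨y.1, hy.2⟩ : ↥(bset D'.toDomains)).1.2 u'.1.2
          = tdistK (ℓ := ℓ) (Mh := Mh) (k := k) (P := P) y.1.2 u'.1.2 := rfl
      linarith
    have hexp : Real.exp (-(δ * (geomT D').dist ⟨y.1, hy.2⟩ u')) * Real.exp (-(δ * dOmega D D' u'.1.2 v.1.2))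
          * Real.exp (-(δ * (geomT D).dist y' v))
        ≤ Real.exp δ * Real.exp (-(δ / 2 * dOmega D D' y.1.2 y'.1.2))
          * (Real.exp (-(δ / 4 * (geomT D').dist ⟨y.1, hy.2⟩ u')) * Real.exp (-(δ / 4 * (geomT D).dist y' v))) := by
      rw [← Real.exp_add, ← Real.exp_add, ← Real.exp_add, ← Real.exp_add, ← Real.exp_add, Real.exp_le_exp]
      linarith [mul_le_mul_of_nonneg_left hΩ hδ, mul_nonneg hδ (hd0' ⟨y.1, hy.2⟩ u'), mul_nonneg hδ (hd0 y' v),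
        mul_nonneg hδ (hΩ0 u'.1.2 v.1.2)]
    calc |TL' (lam D' u') x| * |CinvT D a ⟨u'.1, hu.2⟩ v - CinvT D' a u' ⟨v.1, hv.2⟩| * |(S *ᵥ lam D v) x'|
        ≤ (CE * ((ℓ : ℝ) + 1) ^ (nL * k) * Real.exp (-(δ * (geomT D').dist ⟨y.1, hy.2⟩ u')))
          * (CΔ * (((ℓ : ℝ) + 1) ^ (4 * k))⁻¹ * (W D.toDomains y')⁻¹ * Real.exp (-(δ * dOmega D D' u'.1.2 v.1.2)))
          * (CE * ((ℓ : ℝ) + 1) ^ (nR * k) * Real.exp (-(δ * (geomT D).dist y' v))) :=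
          mul_le_mul (mul_le_mul hEu hM (abs_nonneg _) (by positivity)) hFv (abs_nonneg _) (by positivity)
      _ = CE ^ 2 * CΔ
          * (((ℓ : ℝ) + 1) ^ (nL * k) * ((ℓ : ℝ) + 1) ^ (nR * k) * (((ℓ : ℝ) + 1) ^ (4 * k))⁻¹ * (W D.toDomains y')⁻¹)
          * (Real.exp (-(δ * (geomT D').dist ⟨y.1, hy.2⟩ u')) * Real.exp (-(δ * dOmega D D' u'.1.2 v.1.2))
            * Real.exp (-(δ * (geomT D).dist y' v))) := by ring
      _ ≤ CE ^ 2 * CΔ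
          * (((ℓ : ℝ) + 1) ^ (nL * k) * ((ℓ : ℝ) + 1) ^ (nR * k) * (((ℓ : ℝ) + 1) ^ (4 * k))⁻¹ * (W D.toDomains y')⁻¹)
          * (Real.exp δ * Real.exp (-(δ / 2 * dOmega D D' y.1.2 y'.1.2))
            * (Real.exp (-(δ / 4 * (geomT D').dist ⟨y.1, hy.2⟩ u')) * Real.exp (-(δ / 4 * (geomT D).dist y' v)))) :=
          mul_le_mul_of_nonneg_left hexp (by positivity)
      _ = CE ^ 2 * CΔ * Real.exp δ
          * (((ℓ : ℝ) + 1) ^ (nL * k) * ((ℓ : ℝ) + 1) ^ (nR * k) * (((ℓ : ℝ) + 1) ^ (4 * k))⁻¹ * (W D.toDomains y')⁻¹)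
          * Real.exp (-(δ / 2 * dOmega D D' y.1.2 y'.1.2))
          * (Real.exp (-(δ / 4 * (geomT D').dist ⟨y.1, hy.2⟩ u')) * Real.exp (-(δ / 4 * (geomT D).dist y' v))) := by
          ring
      _ ≤ _ := hshape hK1
  · -- `u′` common top, `v` not: the middle factor is `C[D](u′, v)`, `v` meets `Ωᶜ`
    rw [dif_pos hu, dif_neg hv, sub_zero]
    obtain ⟨hu1, hu2⟩ := hu
    have hM : |CinvT D a ⟨u'.1, hu2⟩ v|
        ≤ CG * (((ℓ : ℝ) + 1) ^ (4 * k))⁻¹ * (W D.toDomains v)⁻¹ * Real.exp (-(δ * (geomT D).dist ⟨u'.1, hu2⟩ v)) := by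
      have h := hC ⟨u'.1, hu2⟩ v
      have e : (⟨u'.1, hu2⟩ : ↥(bset D.toDomains)).1.1 = k := hu1
      rw [e] at h; exact h
    have hWv : 0 < (W D.toDomains v)⁻¹ := inv_pos.2 (W_pos D.toDomains v)
    -- the witness in `v`: `d(y,y′,Ω) ≤ d_{D′}(y,u′) + d_D(u′,v) + d_D(v,y′) + 2`
    obtain ⟨z, hz, hzΩ⟩ := exists_OmegaC_of_not_common' D D' v hv
    have hw := dOmega_le_of_witness' D D' D hMh hP (y₀ := ⟨u'.1, hu2⟩) (b := v) (y₀' := y') hu1 hy'.1 hz hzΩ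
    have ht1 := tdistK_le_distT_of_top D' hMh hP (y := ⟨y.1, hy.2⟩) (u := u') hy.1 hu1
    have h1 := dOmega_le_tdistK_add D D' y.1.2 u'.1.2 y'.1.2
    have hsv := symmT D v y'
    have hΩ : dOmega D D' y.1.2 y'.1.2
        ≤ (geomT D').dist ⟨y.1, hy.2⟩ u' + (geomT D).dist ⟨u'.1, hu2⟩ v + (geomT D).dist y' v + 2 := by
      have e : tdistK (ℓ := ℓ) (Mh := Mh) (k := k) (P := P) (⟨y.1, hy.2⟩ : ↥(bset D'.toDomains)).1.2 u'.1.2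
          = tdistK (ℓ := ℓ) (Mh := Mh) (k := k) (P := P) y.1.2 u'.1.2 := rfl
      have e2 : dOmega D D' (⟨u'.1, hu2⟩ : ↥(bset D.toDomains)).1.2 y'.1.2 = dOmega D D' u'.1.2 y'.1.2 := rfl
      linarith
    -- the volume transfer `W(v)⁻¹e^{−¼δd(y′,v)} ≤ L^{d+1}W(y′)⁻¹`
    have htr := transfer_W D hMh hP hRM (σ := δ / 4) (by positivity) hthrW v y' hy'.1
    have hsplit : Real.exp (-(δ * (geomT D).dist y' v))
        = Real.exp (-(δ / 4 * (geomT D).dist y' v)) * Real.exp (-(3 * δ / 4 * (geomT D).dist y' v)) := by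
      rw [← Real.exp_add]; congr 1; ring
    have hexp : Real.exp (-(δ * (geomT D').dist ⟨y.1, hy.2⟩ u')) * Real.exp (-(δ * (geomT D).dist ⟨u'.1, hu2⟩ v))
          * Real.exp (-(3 * δ / 4 * (geomT D).dist y' v))
        ≤ Real.exp δ * Real.exp (-(δ / 2 * dOmega D D' y.1.2 y'.1.2))
          * (Real.exp (-(δ / 4 * (geomT D').dist ⟨y.1, hy.2⟩ u')) * Real.exp (-(δ / 4 * (geomT D).dist y' v))) := by
      rw [← Real.exp_add, ← Real.exp_add, ← Real.exp_add, ← Real.exp_add, ← Real.exp_add, Real.exp_le_exp]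
      linarith [mul_le_mul_of_nonneg_left hΩ hδ, mul_nonneg hδ (hd0' ⟨y.1, hy.2⟩ u'), mul_nonneg hδ (hd0 y' v),
        mul_nonneg hδ (hd0 ⟨u'.1, hu2⟩ v)]
    calc |TL' (lam D' u') x| * |CinvT D a ⟨u'.1, hu2⟩ v| * |(S *ᵥ lam D v) x'|
        ≤ (CE * ((ℓ : ℝ) + 1) ^ (nL * k) * Real.exp (-(δ * (geomT D').dist ⟨y.1, hy.2⟩ u')))
          * (CG * (((ℓ : ℝ) + 1) ^ (4 * k))⁻¹ * (W D.toDomains v)⁻¹ * Real.exp (-(δ * (geomT D).dist ⟨u'.1, hu2⟩ v)))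
          * (CE * ((ℓ : ℝ) + 1) ^ (nR * k) * Real.exp (-(δ * (geomT D).dist y' v))) :=
          mul_le_mul (mul_le_mul hEu hM (abs_nonneg _) (by positivity)) hFv (abs_nonneg _) (by positivity)
      _ = CE ^ 2 * CG
          * (((ℓ : ℝ) + 1) ^ (nL * k) * ((ℓ : ℝ) + 1) ^ (nR * k) * (((ℓ : ℝ) + 1) ^ (4 * k))⁻¹)
          * ((W D.toDomains v)⁻¹ * Real.exp (-(δ / 4 * (geomT D).dist y' v)))
          * (Real.exp (-(δ * (geomT D').dist ⟨y.1, hy.2⟩ u')) * Real.exp (-(δ * (geomT D).dist ⟨u'.1, hu2⟩ v))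
            * Real.exp (-(3 * δ / 4 * (geomT D).dist y' v))) := by
          rw [hsplit]; ring
      _ ≤ CE ^ 2 * CG
          * (((ℓ : ℝ) + 1) ^ (nL * k) * ((ℓ : ℝ) + 1) ^ (nR * k) * (((ℓ : ℝ) + 1) ^ (4 * k))⁻¹)
          * (((ℓ : ℝ) + 1) ^ (d + 1) * (W D.toDomains y')⁻¹)
          * (Real.exp δ * Real.exp (-(δ / 2 * dOmega D D' y.1.2 y'.1.2))
            * (Real.exp (-(δ / 4 * (geomT D').dist ⟨y.1, hy.2⟩ u')) * Real.exp (-(δ / 4 * (geomT D).dist y' v)))) :=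
          mul_le_mul (mul_le_mul_of_nonneg_left htr (by positivity)) hexp (by positivity) (by positivity)
      _ = CE ^ 2 * (CG * ((ℓ : ℝ) + 1) ^ (d + 1)) * Real.exp δ
          * (((ℓ : ℝ) + 1) ^ (nL * k) * ((ℓ : ℝ) + 1) ^ (nR * k) * (((ℓ : ℝ) + 1) ^ (4 * k))⁻¹ * (W D.toDomains y')⁻¹)
          * Real.exp (-(δ / 2 * dOmega D D' y.1.2 y'.1.2))
          * (Real.exp (-(δ / 4 * (geomT D').dist ⟨y.1, hy.2⟩ u')) * Real.exp (-(δ / 4 * (geomT D).dist y' v))) := by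
          ring
      _ ≤ _ := hshape hK2
  · -- `u′` not common top, `v` common top: the middle factor is `C[D′](u′, v)`, `u′` meets `Ωᶜ`
    rw [dif_neg hu, dif_pos hv, zero_sub, abs_neg]
    obtain ⟨hv1, hv2⟩ := hv
    have hWv : W D'.toDomains ⟨v.1, hv2⟩ = W D.toDomains y' := by
      rw [W_eq, W_eq]
      show (((ℓ : ℝ) + 1) ^ v.1.1) ^ (d + 1) = (((ℓ : ℝ) + 1) ^ y'.1.1) ^ (d + 1)
      rw [hv1, hy'.1]
    have e1 : (((ℓ : ℝ) + 1) ^ (4 * u'.1.1))⁻¹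
        = (((ℓ : ℝ) + 1) ^ (4 * k))⁻¹ * (((ℓ : ℝ) + 1) ^ (4 * k) * (((ℓ : ℝ) + 1) ^ (4 * u'.1.1))⁻¹) := by
      rw [← mul_assoc, inv_mul_cancel₀ hL4k0.ne', one_mul]
    have hM : |CinvT D' a u' ⟨v.1, hv2⟩|
        ≤ CG * ((((ℓ : ℝ) + 1) ^ (4 * k))⁻¹ * (((ℓ : ℝ) + 1) ^ (4 * k) * (((ℓ : ℝ) + 1) ^ (4 * u'.1.1))⁻¹))
          * (W D.toDomains y')⁻¹ * Real.exp (-(δ * (geomT D').dist u' ⟨v.1, hv2⟩)) := by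
      have h := hC' u' ⟨v.1, hv2⟩
      rw [hWv, e1] at h; exact h
    -- the witness in `u′`: `d(y,y′,Ω) ≤ d_{D′}(y,u′) + d_{D′}(u′,v) + 2 + d_D(v,y′)`
    obtain ⟨z, hz, hzΩ⟩ := exists_OmegaC_of_not_common D D' u' hu
    have hw := dOmega_le_of_witness' D D' D' hMh hP (y₀ := ⟨y.1, hy.2⟩) (b := u') (y₀' := ⟨v.1, hv2⟩)
      hy.1 hv1 hz hzΩ
    have ht2 := tdistK_le_distT_of_top D hMh hP hv1 hy'.1
    have h2 := dOmega_le_add_tdistK D D' y.1.2 v.1.2 y'.1.2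
    have hsv := symmT D v y'
    have hΩ : dOmega D D' y.1.2 y'.1.2
        ≤ (geomT D').dist ⟨y.1, hy.2⟩ u' + (geomT D').dist u' ⟨v.1, hv2⟩ + (geomT D).dist y' v + 2 := by
      have e : dOmega D D' (⟨y.1, hy.2⟩ : ↥(bset D'.toDomains)).1.2 (⟨v.1, hv2⟩ : ↥(bset D'.toDomains)).1.2
          = dOmega D D' y.1.2 v.1.2 := rfl
      linarith
    -- the scale transfer `L^{4k}/L^{4j(u′)}·e^{−¼δd′(y,u′)} ≤ L⁴`
    have htr := transfer_four D' hMh hP hRM (δ := δ / 2) (by positivity) hthr2 u' ⟨y.1, hy.2⟩ hy.1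
    have hsplit : Real.exp (-(δ * (geomT D').dist ⟨y.1, hy.2⟩ u'))
        = Real.exp (-(δ / 2 / 2 * (geomT D').dist ⟨y.1, hy.2⟩ u'))
          * Real.exp (-(3 * δ / 4 * (geomT D').dist ⟨y.1, hy.2⟩ u')) := by
      rw [← Real.exp_add]; congr 1; ring
    have hexp : Real.exp (-(3 * δ / 4 * (geomT D').dist ⟨y.1, hy.2⟩ u'))
          * Real.exp (-(δ * (geomT D').dist u' ⟨v.1, hv2⟩)) * Real.exp (-(δ * (geomT D).dist y' v))
        ≤ Real.exp δ * Real.exp (-(δ / 2 * dOmega D D' y.1.2 y'.1.2))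
          * (Real.exp (-(δ / 4 * (geomT D').dist ⟨y.1, hy.2⟩ u')) * Real.exp (-(δ / 4 * (geomT D).dist y' v))) := by
      rw [← Real.exp_add, ← Real.exp_add, ← Real.exp_add, ← Real.exp_add, ← Real.exp_add, Real.exp_le_exp]
      linarith [mul_le_mul_of_nonneg_left hΩ hδ, mul_nonneg hδ (hd0' ⟨y.1, hy.2⟩ u'), mul_nonneg hδ (hd0 y' v),
        mul_nonneg hδ (hd0' u' ⟨v.1, hv2⟩)]
    have hu0 : 0 < ((ℓ : ℝ) + 1) ^ (4 * u'.1.1) := by positivity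
    calc |TL' (lam D' u') x| * |CinvT D' a u' ⟨v.1, hv2⟩| * |(S *ᵥ lam D v) x'|
        ≤ (CE * ((ℓ : ℝ) + 1) ^ (nL * k) * Real.exp (-(δ * (geomT D').dist ⟨y.1, hy.2⟩ u')))
          * (CG * ((((ℓ : ℝ) + 1) ^ (4 * k))⁻¹ * (((ℓ : ℝ) + 1) ^ (4 * k) * (((ℓ : ℝ) + 1) ^ (4 * u'.1.1))⁻¹))
            * (W D.toDomains y')⁻¹ * Real.exp (-(δ * (geomT D').dist u' ⟨v.1, hv2⟩)))
          * (CE * ((ℓ : ℝ) + 1) ^ (nR * k) * Real.exp (-(δ * (geomT D).dist y' v))) :=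
          mul_le_mul (mul_le_mul hEu hM (abs_nonneg _) (by positivity)) hFv (abs_nonneg _) (by positivity)
      _ = CE ^ 2 * CG
          * (((ℓ : ℝ) + 1) ^ (nL * k) * ((ℓ : ℝ) + 1) ^ (nR * k) * (((ℓ : ℝ) + 1) ^ (4 * k))⁻¹ * (W D.toDomains y')⁻¹)
          * (((ℓ : ℝ) + 1) ^ (4 * k) * (((ℓ : ℝ) + 1) ^ (4 * u'.1.1))⁻¹
              * Real.exp (-(δ / 2 / 2 * (geomT D').dist ⟨y.1, hy.2⟩ u')))
          * (Real.exp (-(3 * δ / 4 * (geomT D').dist ⟨y.1, hy.2⟩ u'))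
            * Real.exp (-(δ * (geomT D').dist u' ⟨v.1, hv2⟩)) * Real.exp (-(δ * (geomT D).dist y' v))) := by
          rw [hsplit]; ring
      _ ≤ CE ^ 2 * CG
          * (((ℓ : ℝ) + 1) ^ (nL * k) * ((ℓ : ℝ) + 1) ^ (nR * k) * (((ℓ : ℝ) + 1) ^ (4 * k))⁻¹ * (W D.toDomains y')⁻¹)
          * ((ℓ : ℝ) + 1) ^ 4
          * (Real.exp δ * Real.exp (-(δ / 2 * dOmega D D' y.1.2 y'.1.2))
            * (Real.exp (-(δ / 4 * (geomT D').dist ⟨y.1, hy.2⟩ u')) * Real.exp (-(δ / 4 * (geomT D).dist y' v)))) :=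
          mul_le_mul (mul_le_mul_of_nonneg_left htr (by positivity)) hexp (by positivity) (by positivity)
      _ = CE ^ 2 * (CG * ((ℓ : ℝ) + 1) ^ 4) * Real.exp δ
          * (((ℓ : ℝ) + 1) ^ (nL * k) * ((ℓ : ℝ) + 1) ^ (nR * k) * (((ℓ : ℝ) + 1) ^ (4 * k))⁻¹ * (W D.toDomains y')⁻¹)
          * Real.exp (-(δ / 2 * dOmega D D' y.1.2 y'.1.2))
          * (Real.exp (-(δ / 4 * (geomT D').dist ⟨y.1, hy.2⟩ u')) * Real.exp (-(δ / 4 * (geomT D).dist y' v))) := by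
          ring
      _ ≤ _ := hshape hK3
  · -- neither: the term vanishes
    rw [dif_neg hu, dif_neg hv, sub_zero, abs_zero, mul_zero, zero_mul]
    exact le_trans (le_refl 0) (by positivity)


omit D in
/-- **THE INNER FACTOR `(E′·C′)(u′) = Σ_{w′} (T′λ′_{w′})(x)·C′(w′, u′)` OF TERM C** (family `D′`, top block `t ∋ x`):
`|(E′·C′)(u′)| ≤ C_EC_Gc·L⁴·L^{n_Lk}·L^{−4k}·W′(u′)⁻¹·e^{−½δd′(t,u′)}` — the scale `L^{−4j(w′)}` rides to `L^{−4k}` by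
`transfer_four`, the chain `t → w′ → u′` by the triangle inequality, the sum by (2.61).
[cite: Balaban1985BackgroundPropagators, (3.49) p.399, p.398; Balaban1984PropagatorsII, (2.87) p.238, (2.60)–(2.61) p.234] -/
theorem inner_g_le (hMh : 1 ≤ Mh) (hP : ∀ μ, 1 ≤ P μ) (hRM : 1 ≤ R * ((ℓ + 1) * Mh))
    {TL' : Module.End ℝ (↥(boxDom (N0 ℓ Mh k P)) → ℝ)} {x : ↥(boxDom (N0 ℓ Mh k P))}
    {CE CG δ c : ℝ} {nL : ℕ} (hCE : 0 ≤ CE) (hCG : 0 ≤ CG) (hδ : 0 ≤ δ)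
    {t : ↥(bset D'.toDomains)} (ht : t.1.1 = k)
    (hE' : ∀ s' : ↥(bset D'.toDomains), |TL' (lam D' s') x|
      ≤ CE * ((ℓ : ℝ) + 1) ^ (nL * k) * Real.exp (-(δ * (geomT D').dist t s')))
    (hC' : ∀ u' v' : ↥(bset D'.toDomains), |CinvT D' a u' v'|
      ≤ CG * (((ℓ : ℝ) + 1) ^ (4 * u'.1.1))⁻¹ * (W D'.toDomains v')⁻¹ * Real.exp (-(δ * (geomT D').dist u' v')))
    (hthr2 : ((ℓ : ℝ) + 1) ^ 2 ≤ Real.exp (1 / 4 * (δ / 2) * ((R : ℝ) * (((ℓ : ℝ) + 1) * Mh) - 1)))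
    (h261' : Ineq261With c (geomT D') δ (1 / 4)) (u' : ↥(bset D'.toDomains)) :
    |∑ w' : ↥(bset D'.toDomains), TL' (lam D' w') x * CinvT D' a w' u'|
      ≤ CE * CG * c * ((ℓ : ℝ) + 1) ^ 4 * ((ℓ : ℝ) + 1) ^ (nL * k) * (((ℓ : ℝ) + 1) ^ (4 * k))⁻¹
          * (W D'.toDomains u')⁻¹ * Real.exp (-(δ / 2 * (geomT D').dist t u')) := by
  have hd0' : ∀ s t : ↥(bset D'.toDomains), 0 ≤ (geomT D').dist s t := (triangle_refl_nonneg_T D' hMh hP).2.2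
  have htri : ∀ s t r : ↥(bset D'.toDomains), (geomT D').dist s r ≤ (geomT D').dist s t + (geomT D').dist t r :=
    (triangle_refl_nonneg_T D' hMh hP).1
  have hc0 : 0 ≤ c := c261_nonneg D' h261' t
  have hWu : 0 < (W D'.toDomains u')⁻¹ := inv_pos.2 (W_pos D'.toDomains u')
  have hL4k0 : (0 : ℝ) < ((ℓ : ℝ) + 1) ^ (4 * k) := by positivity
  have hw : ∀ w' : ↥(bset D'.toDomains), |TL' (lam D' w') x * CinvT D' a w' u'|
      ≤ CE * CG * ((ℓ : ℝ) + 1) ^ 4 * ((ℓ : ℝ) + 1) ^ (nL * k) * (((ℓ : ℝ) + 1) ^ (4 * k))⁻¹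
          * (W D'.toDomains u')⁻¹ * Real.exp (-(δ / 2 * (geomT D').dist t u'))
          * Real.exp (-(δ / 4 * (geomT D').dist t w')) := by
    intro w'
    rw [abs_mul]
    have hw0 : 0 < ((ℓ : ℝ) + 1) ^ (4 * w'.1.1) := by positivity
    have e1 : (((ℓ : ℝ) + 1) ^ (4 * w'.1.1))⁻¹
        = (((ℓ : ℝ) + 1) ^ (4 * k))⁻¹ * (((ℓ : ℝ) + 1) ^ (4 * k) * (((ℓ : ℝ) + 1) ^ (4 * w'.1.1))⁻¹) := by
      rw [← mul_assoc, inv_mul_cancel₀ hL4k0.ne', one_mul]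
    have hCw : |CinvT D' a w' u'|
        ≤ CG * ((((ℓ : ℝ) + 1) ^ (4 * k))⁻¹ * (((ℓ : ℝ) + 1) ^ (4 * k) * (((ℓ : ℝ) + 1) ^ (4 * w'.1.1))⁻¹))
          * (W D'.toDomains u')⁻¹ * Real.exp (-(δ * (geomT D').dist w' u')) := by
      have h := hC' w' u'; rw [e1] at h; exact h
    have htr := transfer_four D' hMh hP hRM (δ := δ / 2) (by positivity) hthr2 w' t ht
    have hsplit : Real.exp (-(δ * (geomT D').dist t w'))
        = Real.exp (-(δ / 2 / 2 * (geomT D').dist t w')) * Real.exp (-(3 * δ / 4 * (geomT D').dist t w')) := by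
      rw [← Real.exp_add]; congr 1; ring
    have hexp : Real.exp (-(3 * δ / 4 * (geomT D').dist t w')) * Real.exp (-(δ * (geomT D').dist w' u'))
        ≤ Real.exp (-(δ / 2 * (geomT D').dist t u')) * Real.exp (-(δ / 4 * (geomT D').dist t w')) := by
      rw [← Real.exp_add, ← Real.exp_add, Real.exp_le_exp]
      linarith [mul_le_mul_of_nonneg_left (htri t w' u') hδ, mul_nonneg hδ (hd0' t w'), mul_nonneg hδ (hd0' w' u')]
    calc |TL' (lam D' w') x| * |CinvT D' a w' u'|
        ≤ (CE * ((ℓ : ℝ) + 1) ^ (nL * k) * Real.exp (-(δ * (geomT D').dist t w')))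
            * (CG * ((((ℓ : ℝ) + 1) ^ (4 * k))⁻¹ * (((ℓ : ℝ) + 1) ^ (4 * k) * (((ℓ : ℝ) + 1) ^ (4 * w'.1.1))⁻¹))
              * (W D'.toDomains u')⁻¹ * Real.exp (-(δ * (geomT D').dist w' u'))) :=
          mul_le_mul (hE' w') hCw (abs_nonneg _) (by positivity)
      _ = CE * CG * ((ℓ : ℝ) + 1) ^ (nL * k) * (((ℓ : ℝ) + 1) ^ (4 * k))⁻¹ * (W D'.toDomains u')⁻¹
            * (((ℓ : ℝ) + 1) ^ (4 * k) * (((ℓ : ℝ) + 1) ^ (4 * w'.1.1))⁻¹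
              * Real.exp (-(δ / 2 / 2 * (geomT D').dist t w')))
            * (Real.exp (-(3 * δ / 4 * (geomT D').dist t w')) * Real.exp (-(δ * (geomT D').dist w' u'))) := by
          rw [hsplit]; ring
      _ ≤ CE * CG * ((ℓ : ℝ) + 1) ^ (nL * k) * (((ℓ : ℝ) + 1) ^ (4 * k))⁻¹ * (W D'.toDomains u')⁻¹
            * ((ℓ : ℝ) + 1) ^ 4
            * (Real.exp (-(δ / 2 * (geomT D').dist t u')) * Real.exp (-(δ / 4 * (geomT D').dist t w'))) :=
          mul_le_mul (mul_le_mul_of_nonneg_left htr (by positivity)) hexp (by positivity) (by positivity)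
      _ = _ := by ring
  calc |∑ w' : ↥(bset D'.toDomains), TL' (lam D' w') x * CinvT D' a w' u'|
      ≤ ∑ w' : ↥(bset D'.toDomains), |TL' (lam D' w') x * CinvT D' a w' u'| := Finset.abs_sum_le_sum_abs _ _
    _ ≤ ∑ w' : ↥(bset D'.toDomains), CE * CG * ((ℓ : ℝ) + 1) ^ 4 * ((ℓ : ℝ) + 1) ^ (nL * k)
          * (((ℓ : ℝ) + 1) ^ (4 * k))⁻¹ * (W D'.toDomains u')⁻¹ * Real.exp (-(δ / 2 * (geomT D').dist t u'))
          * Real.exp (-(δ / 4 * (geomT D').dist t w')) := Finset.sum_le_sum fun w' _ => hw w'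
    _ = CE * CG * ((ℓ : ℝ) + 1) ^ 4 * ((ℓ : ℝ) + 1) ^ (nL * k)
          * (((ℓ : ℝ) + 1) ^ (4 * k))⁻¹ * (W D'.toDomains u')⁻¹ * Real.exp (-(δ / 2 * (geomT D').dist t u'))
          * ∑ w' : ↥(bset D'.toDomains), Real.exp (-(δ / 4 * (geomT D').dist t w')) := by rw [Finset.mul_sum]
    _ ≤ CE * CG * ((ℓ : ℝ) + 1) ^ 4 * ((ℓ : ℝ) + 1) ^ (nL * k)
          * (((ℓ : ℝ) + 1) ^ (4 * k))⁻¹ * (W D'.toDomains u')⁻¹ * Real.exp (-(δ / 2 * (geomT D').dist t u')) * c :=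
        mul_le_mul_of_nonneg_left (sum_exp_le D' h261' t) (by positivity)
    _ = _ := by ring

/-- **TERM C, ONE BLOCK `u′ ∈ 𝔅[D′]`**: `|(E′·C′)(u′)|·|(τF − F′)(u′)| ≤ K_C·Λ·e^{−¼δd(y,y′,Ω)}·e^{−¼δd_{D′}(y,u′)}`,
`K_C = C_EC_Gc·L⁴·(C_Δ + C_EL^{d+1}e^{δ/2})`: if `u′` is a common top block the second factor is the two-family difference of
the right letter at `x′` (`≤ C_ΔL^{n_Rk}e^{−δd(y′,u′,Ω)}`, gen-18 members) and `d(y,y′,Ω) ≤ |y − u′| + d(u′,y′,Ω)`;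
otherwise `u′` meets `Ωᶜ`, the single-family letter decays from the top block `y′ ∋ x′` of `D′`, the volume `W′(u′)⁻¹`
rides to `W(y′)⁻¹` by `transfer_W`, and §1's witness inequality gives (3.154).
[cite: Balaban1985BackgroundPropagators, Thm 3.14 (3.154) pp.426–427, (3.49) p.399; Balaban1984PropagatorsII, (2.60) p.234, (2.87) p.238] -/
theorem termC_le (hMh : 1 ≤ Mh) (hP : ∀ μ, 1 ≤ P μ) (hRM : 1 ≤ R * ((ℓ + 1) * Mh))
    {TL' : Module.End ℝ (↥(boxDom (N0 ℓ Mh k P)) → ℝ)}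
    {S S' : Matrix ↥(boxDom (N0 ℓ Mh k P)) ↥(boxDom (N0 ℓ Mh k P)) ℝ} {x x' : ↥(boxDom (N0 ℓ Mh k P))}
    {CE CG CΔ δ c : ℝ} {nL nR : ℕ} (hCE : 0 ≤ CE) (hCG : 0 ≤ CG) (hCΔ : 0 ≤ CΔ) (hδ : 0 ≤ δ)
    {y y' : ↥(bset D.toDomains)} (hy : y.1.1 = k ∧ y.1 ∈ bset D'.toDomains)
    (hy' : y'.1.1 = k ∧ y'.1 ∈ bset D'.toDomains)
    (hE' : ∀ s' : ↥(bset D'.toDomains), |TL' (lam D' s') x|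
      ≤ CE * ((ℓ : ℝ) + 1) ^ (nL * k) * Real.exp (-(δ * (geomT D').dist ⟨y.1, hy.2⟩ s')))
    (hF' : ∀ s' : ↥(bset D'.toDomains), |(S' *ᵥ lam D' s') x'|
      ≤ CE * ((ℓ : ℝ) + 1) ^ (nR * k) * Real.exp (-(δ * (geomT D').dist ⟨y'.1, hy'.2⟩ s')))
    (hC' : ∀ u' v' : ↥(bset D'.toDomains), |CinvT D' a u' v'|
      ≤ CG * (((ℓ : ℝ) + 1) ^ (4 * u'.1.1))⁻¹ * (W D'.toDomains v')⁻¹ * Real.exp (-(δ * (geomT D').dist u' v')))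
    (hΔF : ∀ u' : ↥(bset D'.toDomains), u'.1.1 = k ∧ u'.1 ∈ bset D.toDomains →
      |(S *ᵥ lam D' u') x' - (S' *ᵥ lam D' u') x'|
        ≤ CΔ * ((ℓ : ℝ) + 1) ^ (nR * k) * Real.exp (-(δ * dOmega D D' y'.1.2 u'.1.2)))
    (hthr2 : ((ℓ : ℝ) + 1) ^ 2 ≤ Real.exp (1 / 4 * (δ / 2) * ((R : ℝ) * (((ℓ : ℝ) + 1) * Mh) - 1)))
    (hthrW : ((ℓ : ℝ) + 1) ^ (d + 1) ≤ Real.exp (δ / 4 * ((R : ℝ) * (((ℓ : ℝ) + 1) * Mh) - 1)))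
    (h261' : Ineq261With c (geomT D') δ (1 / 4)) (u' : ↥(bset D'.toDomains)) :
    |∑ w' : ↥(bset D'.toDomains), TL' (lam D' w') x * CinvT D' a w' u'|
        * |(if u'.1.1 = k ∧ u'.1 ∈ bset D.toDomains then (S *ᵥ lam D' u') x' else 0) - (S' *ᵥ lam D' u') x'|
      ≤ (CE * CG * c * ((ℓ : ℝ) + 1) ^ 4) * (CΔ + CE * ((ℓ : ℝ) + 1) ^ (d + 1) * Real.exp (δ / 2))
          * (((ℓ : ℝ) + 1) ^ (nL * k) * ((ℓ : ℝ) + 1) ^ (nR * k) * (((ℓ : ℝ) + 1) ^ (4 * k))⁻¹ * (W D.toDomains y')⁻¹)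
          * Real.exp (-(δ / 4 * dOmega D D' y.1.2 y'.1.2))
          * Real.exp (-(δ / 4 * (geomT D').dist ⟨y.1, hy.2⟩ u')) := by
  have hL1 : (1 : ℝ) ≤ (ℓ : ℝ) + 1 := by linarith [(Nat.cast_nonneg ℓ : (0 : ℝ) ≤ ℓ)]
  have hL0 : (0 : ℝ) < (ℓ : ℝ) + 1 := by positivity
  have hd0' : ∀ s t : ↥(bset D'.toDomains), 0 ≤ (geomT D').dist s t := (triangle_refl_nonneg_T D' hMh hP).2.2
  have hΩ0 : ∀ β β', 0 ≤ dOmega D D' β β' := dOmega_nonneg D D'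
  have hc0 : 0 ≤ c := c261_nonneg D' h261' u'
  have hL4k0 : (0 : ℝ) < ((ℓ : ℝ) + 1) ^ (4 * k) := by positivity
  -- all volumes in powers of `L` (no cross-family `W`-atoms)
  have eWy : (W D.toDomains y')⁻¹ = ((((ℓ : ℝ) + 1) ^ k) ^ (d + 1))⁻¹ := by rw [W_eq, hy'.1]
  rw [eWy]
  have hg := inner_g_le D' a hMh hP hRM hCE hCG hδ (t := ⟨y.1, hy.2⟩) hy.1 hE' hC' hthr2 h261' u'
  rw [W_eq] at hg
  -- the final shape is monotone in the middle constant
  have hZ0 : 0 ≤ (CE * CG * c * ((ℓ : ℝ) + 1) ^ 4)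
      * (((ℓ : ℝ) + 1) ^ (nL * k) * ((ℓ : ℝ) + 1) ^ (nR * k) * (((ℓ : ℝ) + 1) ^ (4 * k))⁻¹
        * ((((ℓ : ℝ) + 1) ^ k) ^ (d + 1))⁻¹)
      * Real.exp (-(δ / 4 * dOmega D D' y.1.2 y'.1.2))
      * Real.exp (-(δ / 4 * (geomT D').dist ⟨y.1, hy.2⟩ u')) := by positivity
  have hshape : ∀ {K : ℝ}, K ≤ CΔ + CE * ((ℓ : ℝ) + 1) ^ (d + 1) * Real.exp (δ / 2) →
      (CE * CG * c * ((ℓ : ℝ) + 1) ^ 4) * K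
        * (((ℓ : ℝ) + 1) ^ (nL * k) * ((ℓ : ℝ) + 1) ^ (nR * k) * (((ℓ : ℝ) + 1) ^ (4 * k))⁻¹
          * ((((ℓ : ℝ) + 1) ^ k) ^ (d + 1))⁻¹)
        * Real.exp (-(δ / 4 * dOmega D D' y.1.2 y'.1.2))
        * Real.exp (-(δ / 4 * (geomT D').dist ⟨y.1, hy.2⟩ u'))
      ≤ (CE * CG * c * ((ℓ : ℝ) + 1) ^ 4) * (CΔ + CE * ((ℓ : ℝ) + 1) ^ (d + 1) * Real.exp (δ / 2))
        * (((ℓ : ℝ) + 1) ^ (nL * k) * ((ℓ : ℝ) + 1) ^ (nR * k) * (((ℓ : ℝ) + 1) ^ (4 * k))⁻¹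
          * ((((ℓ : ℝ) + 1) ^ k) ^ (d + 1))⁻¹)
        * Real.exp (-(δ / 4 * dOmega D D' y.1.2 y'.1.2))
        * Real.exp (-(δ / 4 * (geomT D').dist ⟨y.1, hy.2⟩ u')) := by
    intro K hK
    have := mul_le_mul_of_nonneg_right hK hZ0
    calc _ = K * ((CE * CG * c * ((ℓ : ℝ) + 1) ^ 4)
        * (((ℓ : ℝ) + 1) ^ (nL * k) * ((ℓ : ℝ) + 1) ^ (nR * k) * (((ℓ : ℝ) + 1) ^ (4 * k))⁻¹
          * ((((ℓ : ℝ) + 1) ^ k) ^ (d + 1))⁻¹)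
        * Real.exp (-(δ / 4 * dOmega D D' y.1.2 y'.1.2))
        * Real.exp (-(δ / 4 * (geomT D').dist ⟨y.1, hy.2⟩ u'))) := by ring
      _ ≤ _ := this
      _ = _ := by ring
  have hLd : 0 ≤ CE * ((ℓ : ℝ) + 1) ^ (d + 1) * Real.exp (δ / 2) := by positivity
  have hK1 : CΔ ≤ CΔ + CE * ((ℓ : ℝ) + 1) ^ (d + 1) * Real.exp (δ / 2) := by linarith
  have hK2 : CE * ((ℓ : ℝ) + 1) ^ (d + 1) * Real.exp (δ / 2) ≤ CΔ + CE * ((ℓ : ℝ) + 1) ^ (d + 1) * Real.exp (δ / 2) := by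
    linarith
  by_cases hu : u'.1.1 = k ∧ u'.1 ∈ bset D.toDomains
  · -- `u′` common top: the two-family difference of the right letter
    rw [if_pos hu]
    have hA := hΔF u' hu
    rw [hu.1] at hg
    -- geometry: `d(y,y′,Ω) ≤ d_{D′}(y,u′) + d(u′,y′,Ω)`
    have ht := tdistK_le_distT_of_top D' hMh hP (y := ⟨y.1, hy.2⟩) (u := u') hy.1 hu.1
    have h1 := dOmega_le_tdistK_add D D' y.1.2 u'.1.2 y'.1.2
    have hgeo : dOmega D D' y.1.2 y'.1.2 ≤ (geomT D').dist ⟨y.1, hy.2⟩ u' + dOmega D D' y'.1.2 u'.1.2 := by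
      have hc := dOmega_comm D D' y'.1.2 u'.1.2
      have e : tdistK (ℓ := ℓ) (Mh := Mh) (k := k) (P := P) (⟨y.1, hy.2⟩ : ↥(bset D'.toDomains)).1.2 u'.1.2
          = tdistK (ℓ := ℓ) (Mh := Mh) (k := k) (P := P) y.1.2 u'.1.2 := rfl
      linarith
    have hexp : Real.exp (-(δ / 2 * (geomT D').dist ⟨y.1, hy.2⟩ u')) * Real.exp (-(δ * dOmega D D' y'.1.2 u'.1.2))
        ≤ Real.exp (-(δ / 4 * dOmega D D' y.1.2 y'.1.2)) * Real.exp (-(δ / 4 * (geomT D').dist ⟨y.1, hy.2⟩ u')) := by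
      rw [← Real.exp_add, ← Real.exp_add, Real.exp_le_exp]
      linarith [mul_le_mul_of_nonneg_left hgeo hδ, mul_nonneg hδ (hd0' ⟨y.1, hy.2⟩ u'),
        mul_nonneg hδ (hΩ0 y'.1.2 u'.1.2)]
    calc |∑ w' : ↥(bset D'.toDomains), TL' (lam D' w') x * CinvT D' a w' u'|
          * |(S *ᵥ lam D' u') x' - (S' *ᵥ lam D' u') x'|
        ≤ (CE * CG * c * ((ℓ : ℝ) + 1) ^ 4 * ((ℓ : ℝ) + 1) ^ (nL * k) * (((ℓ : ℝ) + 1) ^ (4 * k))⁻¹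
            * ((((ℓ : ℝ) + 1) ^ k) ^ (d + 1))⁻¹ * Real.exp (-(δ / 2 * (geomT D').dist ⟨y.1, hy.2⟩ u')))
          * (CΔ * ((ℓ : ℝ) + 1) ^ (nR * k) * Real.exp (-(δ * dOmega D D' y'.1.2 u'.1.2))) :=
          mul_le_mul hg hA (abs_nonneg _) (by positivity)
      _ = (CE * CG * c * ((ℓ : ℝ) + 1) ^ 4) * CΔ
          * (((ℓ : ℝ) + 1) ^ (nL * k) * ((ℓ : ℝ) + 1) ^ (nR * k) * (((ℓ : ℝ) + 1) ^ (4 * k))⁻¹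
            * ((((ℓ : ℝ) + 1) ^ k) ^ (d + 1))⁻¹)
          * (Real.exp (-(δ / 2 * (geomT D').dist ⟨y.1, hy.2⟩ u')) * Real.exp (-(δ * dOmega D D' y'.1.2 u'.1.2))) := by
          ring
      _ ≤ (CE * CG * c * ((ℓ : ℝ) + 1) ^ 4) * CΔ
          * (((ℓ : ℝ) + 1) ^ (nL * k) * ((ℓ : ℝ) + 1) ^ (nR * k) * (((ℓ : ℝ) + 1) ^ (4 * k))⁻¹
            * ((((ℓ : ℝ) + 1) ^ k) ^ (d + 1))⁻¹)
          * (Real.exp (-(δ / 4 * dOmega D D' y.1.2 y'.1.2)) * Real.exp (-(δ / 4 * (geomT D').dist ⟨y.1, hy.2⟩ u'))) :=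
          mul_le_mul_of_nonneg_left hexp (by positivity)
      _ = (CE * CG * c * ((ℓ : ℝ) + 1) ^ 4) * CΔ
          * (((ℓ : ℝ) + 1) ^ (nL * k) * ((ℓ : ℝ) + 1) ^ (nR * k) * (((ℓ : ℝ) + 1) ^ (4 * k))⁻¹
            * ((((ℓ : ℝ) + 1) ^ k) ^ (d + 1))⁻¹)
          * Real.exp (-(δ / 4 * dOmega D D' y.1.2 y'.1.2))
          * Real.exp (-(δ / 4 * (geomT D').dist ⟨y.1, hy.2⟩ u')) := by ring
      _ ≤ _ := hshape hK1
  · -- `u′` not common top: single-family right letter from `y′`, witness in `u′`, volume transfer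
    rw [if_neg hu, zero_sub, abs_neg]
    have hA := hF' u'
    obtain ⟨z, hz, hzΩ⟩ := exists_OmegaC_of_not_common D D' u' hu
    have hw := dOmega_le_of_witness' D D' D' hMh hP (y₀ := ⟨y.1, hy.2⟩) (b := u') (y₀' := ⟨y'.1, hy'.2⟩)
      hy.1 hy'.1 hz hzΩ
    have hsu := symmT D' u' ⟨y'.1, hy'.2⟩
    have hΩ : dOmega D D' y.1.2 y'.1.2
        ≤ (geomT D').dist ⟨y.1, hy.2⟩ u' + (geomT D').dist ⟨y'.1, hy'.2⟩ u' + 2 := by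
      have e : dOmega D D' (⟨y.1, hy.2⟩ : ↥(bset D'.toDomains)).1.2 (⟨y'.1, hy'.2⟩ : ↥(bset D'.toDomains)).1.2
          = dOmega D D' y.1.2 y'.1.2 := rfl
      linarith
    have htr := transfer_inv D' hMh hP hRM (σ := δ / 4) (by positivity) (d + 1) hthrW u' ⟨y'.1, hy'.2⟩ hy'.1
    have hu0 : (0 : ℝ) < (((ℓ : ℝ) + 1) ^ u'.1.1) ^ (d + 1) := by positivity
    have hsplit : Real.exp (-(δ * (geomT D').dist ⟨y'.1, hy'.2⟩ u'))
        = Real.exp (-(δ / 4 * (geomT D').dist ⟨y'.1, hy'.2⟩ u'))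
          * Real.exp (-(3 * δ / 4 * (geomT D').dist ⟨y'.1, hy'.2⟩ u')) := by
      rw [← Real.exp_add]; congr 1; ring
    have hexp : Real.exp (-(δ / 2 * (geomT D').dist ⟨y.1, hy.2⟩ u'))
          * Real.exp (-(3 * δ / 4 * (geomT D').dist ⟨y'.1, hy'.2⟩ u'))
        ≤ Real.exp (δ / 2) * Real.exp (-(δ / 4 * dOmega D D' y.1.2 y'.1.2))
          * Real.exp (-(δ / 4 * (geomT D').dist ⟨y.1, hy.2⟩ u')) := by
      rw [← Real.exp_add, ← Real.exp_add, ← Real.exp_add, Real.exp_le_exp]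
      linarith [mul_le_mul_of_nonneg_left hΩ hδ, mul_nonneg hδ (hd0' ⟨y.1, hy.2⟩ u'),
        mul_nonneg hδ (hd0' ⟨y'.1, hy'.2⟩ u')]
    calc |∑ w' : ↥(bset D'.toDomains), TL' (lam D' w') x * CinvT D' a w' u'| * |(S' *ᵥ lam D' u') x'|
        ≤ (CE * CG * c * ((ℓ : ℝ) + 1) ^ 4 * ((ℓ : ℝ) + 1) ^ (nL * k) * (((ℓ : ℝ) + 1) ^ (4 * k))⁻¹
            * ((((ℓ : ℝ) + 1) ^ u'.1.1) ^ (d + 1))⁻¹ * Real.exp (-(δ / 2 * (geomT D').dist ⟨y.1, hy.2⟩ u')))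
          * (CE * ((ℓ : ℝ) + 1) ^ (nR * k) * Real.exp (-(δ * (geomT D').dist ⟨y'.1, hy'.2⟩ u'))) :=
          mul_le_mul hg hA (abs_nonneg _) (by positivity)
      _ = (CE * CG * c * ((ℓ : ℝ) + 1) ^ 4) * CE
          * (((ℓ : ℝ) + 1) ^ (nL * k) * ((ℓ : ℝ) + 1) ^ (nR * k) * (((ℓ : ℝ) + 1) ^ (4 * k))⁻¹)
          * (((((ℓ : ℝ) + 1) ^ u'.1.1) ^ (d + 1))⁻¹ * Real.exp (-(δ / 4 * (geomT D').dist ⟨y'.1, hy'.2⟩ u')))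
          * (Real.exp (-(δ / 2 * (geomT D').dist ⟨y.1, hy.2⟩ u'))
            * Real.exp (-(3 * δ / 4 * (geomT D').dist ⟨y'.1, hy'.2⟩ u'))) := by
          rw [hsplit]; ring
      _ ≤ (CE * CG * c * ((ℓ : ℝ) + 1) ^ 4) * CE
          * (((ℓ : ℝ) + 1) ^ (nL * k) * ((ℓ : ℝ) + 1) ^ (nR * k) * (((ℓ : ℝ) + 1) ^ (4 * k))⁻¹)
          * (((ℓ : ℝ) + 1) ^ (d + 1) * ((((ℓ : ℝ) + 1) ^ k) ^ (d + 1))⁻¹)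
          * (Real.exp (δ / 2) * Real.exp (-(δ / 4 * dOmega D D' y.1.2 y'.1.2))
            * Real.exp (-(δ / 4 * (geomT D').dist ⟨y.1, hy.2⟩ u'))) :=
          mul_le_mul (mul_le_mul_of_nonneg_left htr (by positivity)) hexp (by positivity) (by positivity)
      _ = (CE * CG * c * ((ℓ : ℝ) + 1) ^ 4) * (CE * ((ℓ : ℝ) + 1) ^ (d + 1) * Real.exp (δ / 2))
          * (((ℓ : ℝ) + 1) ^ (nL * k) * ((ℓ : ℝ) + 1) ^ (nR * k) * (((ℓ : ℝ) + 1) ^ (4 * k))⁻¹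
            * ((((ℓ : ℝ) + 1) ^ k) ^ (d + 1))⁻¹)
          * Real.exp (-(δ / 4 * dOmega D D' y.1.2 y'.1.2))
          * Real.exp (-(δ / 4 * (geomT D').dist ⟨y.1, hy.2⟩ u')) := by ring
      _ ≤ _ := hshape hK2

end Bounds

end

end Literature.MathematicalPhysics.QuantumFieldTheory.Balaban1983to89.B9Thm314PFlatTransfer
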